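import Summits.HodgeConjecture.HodgeConjecture.Theorems.F0P3cDbTEnvelopeTrichotomy   -- ★ p848339 `constituent_trichotomy_of_memXiFamily` (pin-free envelope trichotomy); brings `MemXiFamily`, `CMCharIdentityPackageTestSigned`, (H₇), `xiLocalChar`
import Summits.HodgeConjecture.HodgeConjecture.Theorems.F0P3cStCharTSNe              -- ★ Ne-glue `ne_comap_keysLabels_of_isSupercuspidal` (a supercuspidal class is neither `πⁿ ∘ e` nor `π² ∘ e`)
import Literature.NumberTheory.Rogawski1990.CharIdentityOnTestFunctionsSignedLemmas  -- ★ `CMNonsplitCharIdentityAtTestSigned.πs` ∕ `.charIdentityAtTestSigned_πs` (the `hQS`-witness `πˢ`)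
import Literature.NumberTheory.Rogawski1990.FinExplicitTransferFactorConjLeft        -- ★ print's `Δ‴`: `finExplicitCollection`, `finExplicitDelta_conj_left_all`
import Literature.NumberTheory.Rogawski1990.FinExplicitTransferFactorConjRight       -- ★ `finExplicitDelta_conj_right_all`
import Literature.NumberTheory.Automorphic.OrbitalMeasureCanonical                   -- ★ `OrbitalMeasureFamily.IsCanonical`, `IsLocalGRegular`, `IsRegularElt`
import Summits.HodgeConjecture.HodgeConjecture.Cruxes.H413.Lines.R90_S9_InnerFormTransportB    -- FILE B (R90-IF-typ2 (g0); ED. 1 commit 5ea9eefa966e, editions are B's own pen's): `XiMembershipAt`, the `sock_S9_*` sockets, paid head `xiMembershipAt_paidB` — PAYS the socket (LAW L9 (β): ★ → B → A → leaf)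
import Summits.HodgeConjecture.HodgeConjecture.Theorems.R90S9PisEqOfCharIdentityAtTestSigned      -- ★ p861411 (R90-IF-p03 (g0), 2dbd6539cd62): `R90.S9.eq_packagePis_of_charIdentityAtTestSigned` — signed completion uniqueness (J3 engine)
import Summits.HodgeConjecture.HodgeConjecture.Cruxes.H413.Lines.F0_T1InnerFormTraceIdentityKit      -- (ED. 4) T1 KIT: `ComparisonKit`, `IsPinned`, `GpAdelic` `GpLocal` `HLocal` `GpInf` `GInf` `HInf` (the letter's kit row)
import Summits.HodgeConjecture.HodgeConjecture.Theorems.F0P3ClassificationKitV6                      -- (ED. 4) ★ V6: `Gp`, `Places`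
import Summits.HodgeConjecture.HodgeConjecture.Theorems.R90S9InnerFormSec146Scope                    -- (ED. 4) ★ p862338∕p862402 `InnerFormSec146.IsKcSpherical` (FROZEN bytes)
import Literature.NumberTheory.Rogawski1990.ArchCanonicalTransferFactor                               -- (ED. 4) ★ `archCanonicalTransferFactor` (the `hpin` binder)
import Literature.NumberTheory.Automorphic.UnitaryGroupBorelInduction                                 -- (ED. 4) ★ `IsQuadraticCharExtension` (`hquad`)
import HarnessLib

/-!
# R90-TF · S9 «InnerForm-13.3.6 (c)» — SOCKET FILE (ED. 4-pre «FRAMED-KIT SOCKETS»; ED. 1–3 declarations byte-frozen): the O2♮ leaf of LH10 re-expressed as ONE NAMED print socket + PROVED junctions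

Cell `hodgecm-mathlib`, crux H413 (`stmt-HodgeConjecture-24833`), route of record `HCCMUnconditional` (no route verbs; count-neutral).  Programme R90-TF
(HUMAN RULING «R90-TF SLAB — MAX PUSH», ladder-directors/REQUESTS.md l.72925; «R90-TF ROSTER» l.72931; brief `director/R90-BRIEF.v2.md` 1f40d54518340a35),
section S9 = InnerForm-13.3.6 (c) (base `R90-IF`).  Seat LH10-typ1 (g0) = S9-typ1 (FOLD-IN of the L6 slot T1 `F0_P3c_O2ScSockets`, desk sheet
`F0/P2/L6/L6-LINE-SHEET.v1.F0P2-plan-g17.md` 8576c30bcfaa0197 §1–§2; renamed to the director's pattern per desk SOCKET CENSUS v2 df58e35ab6b99222 §S9).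
HONEST LABEL: HC_CM is proved only modulo the 7 printed citations (2 remaining named inputs: hLiu418 = stmt-HodgeConjecture-24832, h413 = stmt-HodgeConjecture-24833)
— DISTANCE TO ZERO: citations 3 ∕ leaves 7 (closable 3 · S-layer 4+) ∕ axioms 0 — until rung 0 closes.  This file proves NOTHING printed: it RELABELS the one
sorried organ of the LH10 leaf `Cruxes/H413/Lines/F0_P3c_DbTPaydown.lean` (ED. 9, sha16 817139d6b3e3805d) :423 `stub_xiPacketRigidCoreSc : StubXiPacketRigidCoreSc` (def :342–:414)
to the honest print statement it is — Rogawski's GLOBAL rigidity Thm. 13.3.6 (c) transported to the inner form `U(H)` by §14.6 (Thm. 14.6.1 ∕ 14.6.4), AT PRINT'S PINNED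
DATA — with the two junctions PROVED.  Kernel leaves 7 → 7; distance by name UNCHANGED.

## EDITIONS
ED. 1 (4ec8b02abbbf79d1; WRITTEN commit 36b3d133aee9 by the R90 write-pen A-plan1 (g37) on director s1978; BUILT BW144; F0P2-ref1 (g18) r564 «AUDIT S9#1: CLEAN»,
R90-IF-audit1 (g0) «AUDIT S9#0∕#1∕#2 + J1∕J1⁻¹∕J2∕HEAD∕PAID: CLEAN; no vacuous stub» d62fc2644ac456d6): ONE sorry, the named socket `stub_globalXiMembership`.
ED. 2 «B-PAY» (this; S9 SOCKET PLAN v1.1 = LAW L9 (β), R90-IF-plan (g0)): ONE import (FILE B `R90_S9_InnerFormTransportB`, A-FREE; ED. 1 WRITTEN 5ea9eefa966e + BUILT BW151) and the socket is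
PROVED from B's paid head: `stub_globalXiMembership := fun L _ _ _ H hH hHd => xiMembershipAt_paidB L H hH hHd` — NAME AND STATEMENT BYTES FROZEN (every `def` byte-identical
to ED. 1); + the junction `globalXiMembership_iff_forall_at : SocketGlobalXiMembership ↔ ∀ L … hHd, XiMembershipAt L H hH hHd` (`Iff.rfl`; B0's bytes ARE this file's
(S-G) body :240–:307 with the first four binders as parameters); docstring fix-list of the audits (:322 «§12.7 Lemma 12.7.3 p. 195»; S9#1 print road).  File sorries
1 → 0: the S9 debt now READS B's 4 named sockets {`sock_S9_qsXiMembership`, `sock_S9_indefiniteSimilitude`, `sock_S9_similitudeTransport`, `sock_S9_definiteXiMembership`};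
the LH10 pay line `R90.S9.xiPacketRigidCoreSc_paid` is byte-stable.  Count-neutral: kernel leaves by name LH10 :423 ↦ `stub_globalXiMembership` ↦ B's sockets;
nothing printed is discharged by this edition.
ED. 3 «J3» (folded into the same write when ED. 2 had not yet been written; else the next one): ONE more import (★ `Theorems.R90S9PisEqOfCharIdentityAtTestSigned`, p861411 by
R90-IF-p03 (g0)) and §4 = J3 `scUnique_of_xiPacketRigidCoreSc : TopXiPacketRigidCoreSc → SocketScUnique` + `xiPacketRigidCoreSc_iff_scUnique` + `xiPacketRigidCoreSc_iff_globalXiMembership`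
(PROVED; F0P2-ref1 r564 N1 ∕ R90-IF-audit1 BOX S9-p03 15:37:30Z): the relabel LH10 :423 ↦ S9 is now a kernel EQUIVALENCE (O2♮) ⟺ (S-U) ⟺ (S-G) over ★.  Statement bytes frozen;
count-neutral.
ED. 4-pre «FRAMED-KIT SOCKETS» (RULING S9-R-K (2) 21:58:58Z + S9-R-K-2 22:35:21Z, junction S9-J7, R90-IF-plan (g0)∕(g2); S9-typ1 = LH10-typ1 (g2), generator `mk_framed.py --mode pre`): FIVE more
imports (T1 KIT, ★ V6, ★ Scope p862338, ★ `ArchCanonicalTransferFactor`, ★ `UnitaryGroupBorelInduction`) and §5 = the section's statements RE-TYPED AT THE LETTER'S FRAME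
AND KIT — `TopXiPacketRigidCoreScFramedKit` (O2♮-K), `SocketScUniqueFramedKit` (S-U-K), `SocketGlobalXiMembershipFramedKit` (S-G-K): the consumer telescope of
`F0_P3c_PKtuplePaydown` ED. 6 ORGAN 1 `PKtupleBaseLetterK2μ` :91–:120 + :124–:163 VERBATIM (frame `(ι T hT)` with the letter's own `(hdef) (h2)`, `μ μω hμu hμω`, Haar
carpet, centralizer carpet, K9 inner prefix with the 𝔨-row `hpin htE hstf hΔ hmH hmG`, `hQ`; `hK hLi hg hsm` excluded — S9-J7; no `h3` — S9-R-K-2), ONE inline `haveI`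
(SEAM 1: the `cmDatum`-keyed kit tokens read the `Gp`-keyed automorphic-measure instance), the LH10 local-Δ‴-transfer letter (H₇) `hex` (= `DbTSAtRecordW1`'s binder;
the consumer's `hΔ` is the kit pin, not this letter), `∀ (ξ) (P) (hsph : IsKcSpherical L ι H T hT μ P)` (★ p862338 — `K^c`-fixed `P`), then the ED. 3 tails under
σ = {hH ↦ `transpose_map_cmConjRingHom_eq_of_frame L ι H T hT`, hHd ↦ `isUnit_det_of_frame L ι H T hT`, hQS ↦ hQ, Δ v ↦ Δ‴ v}; the framed junctions
J1-K∕J1⁻¹-K∕J2-K∕J3-K∕HEAD-K + the two `_iff_` certificates PROVED over the same ★ as J1–J3.  NO pay line in this pre-edition: the pointwise pay `(B4b-K) → (S-G-K)` through ★ p861905 lands as ED. 4 once FILE B ED. 4 (framed head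
`sock_S9_definiteAeRigidityFramedKit`) is BUILT (kernel-checked at HOME against B's text: `A-ED4.framed.scratch.lean`).
Every ED. 1–3 declaration byte-frozen; file sorries 0 → 0;
count-neutral: nothing printed is discharged by this edition.

## CONTENTS (all statements over ★ currency; the binders of every `def` below are the (O2♭)∕(O2♮) binders of the leaf :343–:405 BYTE-VERBATIM, with the four
## arrows the conclusions depend on NAMED `hQS`, `hns`, `hK`, `hn`)
* `TopXiPacketRigidCoreSc`  — the section's TOP: the consumer's statement (O2♮) = leaf `StubXiPacketRigidCoreSc` :343–:414 BYTE-IDENTICAL (junction rule, brief §5;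
  byte guard = leaf sha16 817139d6b3e3805d); the leaf cannot be imported here (it will import THIS file), so the TOP is mirrored and consumed by δ-unfolding.
* `SocketScUnique` (S-U) «SC-UNIQUE» (LH10-p02 (g19)): every SUPERCUSPIDAL `v`-constituent `c` of a discrete `P` with `MemXiFamily P … ξ`, at a non-split `v` with
  Keys labels `(π², πⁿ)`, `πⁿ` not `L²`, IS `((hQS ξ).1 v …).πs` — the `πˢ(ξ_v) ∘ e` READ OFF the SIGNED Q-package of record (★ `CMNonsplitCharIdentityAtTestSigned.πs`).
* `SocketGlobalXiMembership` (S-G) «13.3.6 (c) ∕ §14.6 at print's pinned data»: every `v`-constituent `c` of such a `P` is `πⁿ ∘ e` OR `π² ∘ e` OR that `πˢ` — the ★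
  pin-free envelope trichotomy `F0P3cDbTEnvelopeTrichotomy.constituent_trichotomy_of_memXiFamily` (p848339) with its FREE supercuspidal slot PINNED to `πˢ(ξ_v)`.
  THE NAMED SOCKET: `stub_globalXiMembership : SocketGlobalXiMembership` (ED. 1: the file's only `sorry`; ED. 2 «B-PAY»: PROVED from FILE B's paid head `xiMembershipAt_paidB` — NO `sorry` left in this file).
* J3 (ED. 3) `scUnique_of_xiPacketRigidCoreSc : TopXiPacketRigidCoreSc → (S-U)` over ★ `eq_packagePis_of_charIdentityAtTestSigned` + the two `_iff_` certificates (§4).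
* JUNCTIONS (PROVED, no sorry): J1 `scUnique_of_globalXiMembership : (S-G) → (S-U)` (★ Ne-glue kills the `πⁿ`∕`π²` branches at a supercuspidal `c`);
  J1⁻¹ `globalXiMembership_of_scUnique : (S-U) → (S-G)` (★ trichotomy) — so (S-G) ⟺ (S-U) over ★; J2 `xiPacketRigidCoreSc_of_scUnique : (S-U) → TopXiPacketRigidCoreSc`
  (★ `charIdentityAtTestSigned_πs` after `subst`); HEAD `xiPacketRigidCoreSc_of_globalXiMembership : (S-G) → TopXiPacketRigidCoreSc`; PAID HEAD `xiPacketRigidCoreSc_paid`.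
  (The converse O2♮ → (S-U) needs the SIGNED uniqueness lemma `πs_eq_of_charIdentityAtTestSigned` — a ≈10-line S3 Theorems corollary of ★
  `F0P2oCharIdentityCompletionUniqueTest.eq_of_charIdentityAtTest` :140, not yet in the tree; not claimed here.)
* (ED. 4-pre) `TopXiPacketRigidCoreScFramedKit` ∕ `SocketScUniqueFramedKit` ∕ `SocketGlobalXiMembershipFramedKit` — the three statements above AT THE LETTER'S FRAME AND KIT (§5),
  junctions J1-K∕J1⁻¹-K∕J2-K∕J3-K∕HEAD-K + `topFK_iff_globalXiMembershipFK` ∕ `topFK_iff_scUniqueFK` (PROVED).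

## PAY LINES (by name; nothing restated by the consumer)
* LH10 leaf pay line (desk word 15:11:37Z «INDEX-NOW, LEAF AT ★»: recorded in the architect's `R90_TF_Index.lean` now; the leaf re-editions ONCE, sorry-free, when the S9 sockets are ★): `import Summits.HodgeConjecture.HodgeConjecture.Cruxes.H413.Lines.R90_S9_InnerFormXiRigiditySockets` and
  `theorem stub_xiPacketRigidCoreSc : StubXiPacketRigidCoreSc := R90.S9.xiPacketRigidCoreSc_paid` (δ-unfolding; equivalently
  `R90.S9.xiPacketRigidCoreSc_of_scUnique (R90.S9.scUnique_of_globalXiMembership R90.S9.stub_globalXiMembership)`) — leaf :423 ↦ this file's `stub_globalXiMembership`.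
* Architect's index `Lines/R90_TF_Index.lean`: the LH10 S-layer target `F0P3cDbTPaydown.StubXiPacketRigidCoreSc` from sockets = `R90.S9.xiPacketRigidCoreSc_of_globalXiMembership`.
* WHO PAYS `stub_globalXiMembership` (ED. 2+, after S5's spine lands): S5 `stub_R90_1336c_membership` (13.3.6 (c) on the quasi-split `U(3)`, `MemXiFamily` currency) ∘ S6∕§14.6
  transport to `U(H)` + the transport residuals of LH10-p01 (g22) — (i) a.e.-unramified finite part of a discrete `P` + «unramified JH constituent of `i_G(χ_ξ)` = `πⁿ`»
  [§12.2 (2)], (ii) `U(H)_v ≃ U(Φ₃)_v` with the kit pins (★ `cmDatumLocalCongr`), (iii) the `πˢ`-identification SIGNED at `Δ‴` [13.1.4, §4.9] — each to be stated here as a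
  NAMED stub only if strictly weaker than (S-G); else (S-G) stays the one stub (no shred).

[cite: Rogawski1990, §13.3 Thm. 13.3.5, Thm. 13.3.6 (c), Thm. 13.3.7 pp. 201–203; §14.6 Thm. 14.6.1 p. 241, Thm. 14.6.4 p. 243, pp. 241–246; §13.1 Prop. 13.1.3 (d), Prop. 13.1.4 p. 199; §12.2 (2) p. 174; §4.9 p. 55; §14.2 p. 232]
[cite: LanglandsShelstad1987, §1]
-/

set_option autoImplicit false
set_option linter.dupNamespace false

noncomputable section

open NumberField IsDedekindDomain MeasureTheory
open scoped Matrix ComplexOrder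

open Literature.NumberTheory Literature.NumberTheory.Automorphic Literature.NumberTheory.Automorphic.UnitaryGroup
open Literature.NumberTheory.Automorphic.IdeleClassGroup
open Literature.NumberTheory.GaloisRepresentations
open Literature.NumberTheory.Rogawski1990
open Summit.HodgeConjecture.HodgeConjecture.Cruxes.H413
open Summit.HodgeConjecture.HodgeConjecture.Cruxes.H413.F0T1InnerFormTraceIdentity (ComparisonKit GpAdelic GpLocal HLocal GpInf GInf HInf)   -- (ED. 4)
open Summit.HodgeConjecture.HodgeConjecture.Cruxes.H413.F0P3InnerFormClassificationV6 (Gp Places)                                          -- (ED. 4)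
open Summit.HodgeConjecture.HodgeConjecture.R90.S9.InnerFormSec146 (IsKcSpherical)                                                          -- (ED. 4)

namespace Summit.HodgeConjecture.HodgeConjecture.R90.S9

/-! ## §0 The section's TOP = the consumer's statement (O2♮), byte-identical -/

open scoped Classical in
/-- **TOP `TopXiPacketRigidCoreSc` = the LH10 leaf's (O2♮) `F0P3cDbTPaydown.StubXiPacketRigidCoreSc`** (`Cruxes/H413/Lines/F0_P3c_DbTPaydown.lean` ED. 9 sha16
817139d6b3e3805d, :343–:414) BYTE-IDENTICAL, mirrored here because the consumer imports this file (junction rule: a section's TOP states byte-identically the hypothesis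
its consumer needs).  Clause (β) of [13.3.6 (c)] at print's pinned data: every SUPERCUSPIDAL `v`-constituent `c` of a discrete `Π(ξ)`-family member `P` of `U(H)` makes
`⟨πⁿ(ξ_v) ∘ e, some c⟩` satisfy the SIGNED (13.1.4) on test functions at `ξ.xiLocalChar v`.
[cite: Rogawski1990, §13.3 Thm. 13.3.5, Thm. 13.3.6 (c) pp. 201–203; §13.1 Prop. 13.1.3 (d), Prop. 13.1.4 p. 199; §4.9 p. 55; §14.6 pp. 242–245] [cite: LanglandsShelstad1987, §1] -/
def TopXiPacketRigidCoreSc : Prop :=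
  ∀ (L : Type) [Field L] [NumberField L] [IsCMField L] (H : Matrix (Fin 3) (Fin 3) L)
    (hH : (H.map (cmConjRingHom L))ᵀ = H) (hHd : IsUnit H.det)
    [∀ v : HeightOneSpectrum (𝓞 ↥(maximalRealSubfield L)), MeasurableSpace ((cmDatum L 3 H).Local v)]
    [∀ v : HeightOneSpectrum (𝓞 ↥(maximalRealSubfield L)),
      MeasurableSpace ((cmDatum L 2 (Matrix.of fun i j : Fin 2 => if i.val + j.val + 1 = 2 then (1 : L) else 0)).Local v ×
        (cmDatum L 1 (Matrix.of fun i j : Fin 1 => if i.val + j.val + 1 = 1 then (1 : L) else 0)).Local v)]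
    [∀ (v : HeightOneSpectrum (𝓞 ↥(maximalRealSubfield L)))
        (a : ((cmDatum L 2 (Matrix.of fun i j : Fin 2 => if i.val + j.val + 1 = 2 then (1 : L) else 0)).Local v ×
          (cmDatum L 1 (Matrix.of fun i j : Fin 1 => if i.val + j.val + 1 = 1 then (1 : L) else 0)).Local v)),
      MeasurableSpace (((cmDatum L 2 (Matrix.of fun i j : Fin 2 => if i.val + j.val + 1 = 2 then (1 : L) else 0)).Local v ×
          (cmDatum L 1 (Matrix.of fun i j : Fin 1 => if i.val + j.val + 1 = 1 then (1 : L) else 0)).Local v) ⧸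
        Subgroup.centralizer ({a} : Set ((cmDatum L 2 (Matrix.of fun i j : Fin 2 => if i.val + j.val + 1 = 2 then (1 : L) else 0)).Local v ×
          (cmDatum L 1 (Matrix.of fun i j : Fin 1 => if i.val + j.val + 1 = 1 then (1 : L) else 0)).Local v)))]
    [∀ (v : HeightOneSpectrum (𝓞 ↥(maximalRealSubfield L))) (γ : (cmDatum L 3 H).Local v),
      MeasurableSpace ((cmDatum L 3 H).Local v ⧸ Subgroup.centralizer ({γ} : Set ((cmDatum L 3 H).Local v)))]
    (Δ : ∀ v : HeightOneSpectrum (𝓞 ↥(maximalRealSubfield L)), LocalTransferFactor L H v)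
    (mH : ∀ v : HeightOneSpectrum (𝓞 ↥(maximalRealSubfield L)),
      OrbitalMeasureFamily ((cmDatum L 2 (Matrix.of fun i j : Fin 2 => if i.val + j.val + 1 = 2 then (1 : L) else 0)).Local v ×
        (cmDatum L 1 (Matrix.of fun i j : Fin 1 => if i.val + j.val + 1 = 1 then (1 : L) else 0)).Local v))
    (mG : ∀ v : HeightOneSpectrum (𝓞 ↥(maximalRealSubfield L)), OrbitalMeasureFamily ((cmDatum L 3 H).Local v))
    (νG : ∀ v : HeightOneSpectrum (𝓞 ↥(maximalRealSubfield L)), Measure ((cmDatum L 3 H).Local v))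
    (νH : ∀ v : HeightOneSpectrum (𝓞 ↥(maximalRealSubfield L)),
      Measure ((cmDatum L 2 (Matrix.of fun i j : Fin 2 => if i.val + j.val + 1 = 2 then (1 : L) else 0)).Local v ×
        (cmDatum L 1 (Matrix.of fun i j : Fin 1 => if i.val + j.val + 1 = 1 then (1 : L) else 0)).Local v))
    [∀ v : HeightOneSpectrum (𝓞 ↥(maximalRealSubfield L)), BorelSpace ((cmDatum L 3 H).Local v)]
    [∀ v : HeightOneSpectrum (𝓞 ↥(maximalRealSubfield L)),
      BorelSpace ((cmDatum L 2 (Matrix.of fun i j : Fin 2 => if i.val + j.val + 1 = 2 then (1 : L) else 0)).Local v ×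
        (cmDatum L 1 (Matrix.of fun i j : Fin 1 => if i.val + j.val + 1 = 1 then (1 : L) else 0)).Local v)]
    [∀ (v : HeightOneSpectrum (𝓞 ↥(maximalRealSubfield L)))
        (a : ((cmDatum L 2 (Matrix.of fun i j : Fin 2 => if i.val + j.val + 1 = 2 then (1 : L) else 0)).Local v ×
          (cmDatum L 1 (Matrix.of fun i j : Fin 1 => if i.val + j.val + 1 = 1 then (1 : L) else 0)).Local v)),
      BorelSpace (((cmDatum L 2 (Matrix.of fun i j : Fin 2 => if i.val + j.val + 1 = 2 then (1 : L) else 0)).Local v ×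
          (cmDatum L 1 (Matrix.of fun i j : Fin 1 => if i.val + j.val + 1 = 1 then (1 : L) else 0)).Local v) ⧸
        Subgroup.centralizer ({a} : Set ((cmDatum L 2 (Matrix.of fun i j : Fin 2 => if i.val + j.val + 1 = 2 then (1 : L) else 0)).Local v ×
          (cmDatum L 1 (Matrix.of fun i j : Fin 1 => if i.val + j.val + 1 = 1 then (1 : L) else 0)).Local v)))]
    [∀ (v : HeightOneSpectrum (𝓞 ↥(maximalRealSubfield L))) (γ : (cmDatum L 3 H).Local v),
      BorelSpace ((cmDatum L 3 H).Local v ⧸ Subgroup.centralizer ({γ} : Set ((cmDatum L 3 H).Local v)))]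
    [∀ v, (νG v).IsHaarMeasure] [∀ v, (νG v).IsMulRightInvariant] [∀ v, (νH v).IsHaarMeasure] [∀ v, (νH v).IsMulRightInvariant],
    ∀ (μω : HeckeCharacter L) (hμu : μω.IsUnitary),
    (∀ x : Literature.NumberTheory.GaloisRepresentations.ideleGroup ↥(maximalRealSubfield L),
      μω (AdeleRing.ideleBaseChange (↥(maximalRealSubfield L)) L x) = quadraticHeckeCharCM L x) →
    Δ = finExplicitCollection L H μω (finExplicitDelta_conj_left_all L H μω) (finExplicitDelta_conj_right_all L H μω) →
    (∀ v : HeightOneSpectrum (𝓞 ↥(maximalRealSubfield L)), (mH v).IsCanonical (IsLocalGRegular L v) (νH v) ∧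
      (mG v).IsCanonical (fun γ => IsRegularElt (γ.val : GL (Fin 3) (UnitaryGroup.LocalRing L v))) (νG v)) →
    CMCharIdentityPackageTestSigned L H hH hHd νH νG μω hμu Δ mH mG →
    (∀ v : HeightOneSpectrum (𝓞 ↥(maximalRealSubfield L)), (∀ w : PlacesOver L v, IsCMField.complexConj L • w.1 = w.1) →
      IsLocalDeltaTransferExists L H v (Δ v) (mH v) (mG v) Literature.NumberTheory.Rogawski1990.IsLocSmooth
        Literature.NumberTheory.Rogawski1990.IsLocSmooth) →
    ∀ (ξ : OneDimAutRepH L)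
      (μA : Measure (adelicGroupData (↥(maximalRealSubfield L)) L (IsCMField.complexConj L) 3 H).automorphicQuotient)
      [(adelicGroupData (↥(maximalRealSubfield L)) L (IsCMField.complexConj L) 3 H).IsAutomorphicMeasure μA]
      (P : DiscreteAutomorphicRep (adelicGroupData (↥(maximalRealSubfield L)) L (IsCMField.complexConj L) 3 H) μA),
      MemXiFamily P hH hHd μω hμu ξ →
      ∀ (v : HeightOneSpectrum (𝓞 ↥(maximalRealSubfield L))), (∀ w : PlacesOver L v, IsCMField.complexConj L • w.1 = w.1) →
      ∀ (T : GL (Fin 3) (LocalRing L v)) (a : LocalRing L v) (ha : IsUnit a)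
        (h : formCongr (conjLocal L (IsCMField.complexConj L) v) T (H.map (algebraMap L (LocalRing L v))) =
          a • (Matrix.of fun i j : Fin 3 => if i.val + j.val + 1 = 3 then (1 : L) else 0).map (algebraMap L (LocalRing L v))),
      ∀ [MeasurableSpace (Gqs L v ⧸ Subgroup.center (Gqs L v))] [BorelSpace (Gqs L v ⧸ Subgroup.center (Gqs L v))]
        (μZ : Measure (Gqs L v ⧸ Subgroup.center (Gqs L v))) [μZ.IsHaarMeasure],
      ∀ (π2 πn : IrrClass (Gqs L v)),
        KeysCaseTwoLabels L v (μω.semilocalComponent L v) (torusLocalComponent L (IsCMField.complexConj L) v ξ.η)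
          (torusLocalComponent L (IsCMField.complexConj L) v ξ.ψ) π2 πn →
        ¬ πn.IsSquareIntegrable μZ →
        -- (β) «every SUPERCUSPIDAL v-constituent of P completes πⁿ ∘ e in the SIGNED (13.1.4) on test functions»
        ∀ c : IrrClass ((cmDatum L 3 H).Local v),
          (IrrClass.comap (localPiEquiv L (IsCMField.complexConj L) 3 H v) c).IsConstituentOf
              (P.finRep.smoothPart.toRepresentation.comp (inclPlace (↥(maximalRealSubfield L)) L (IsCMField.complexConj L) 3 H v)) →
          c.IsSupercuspidal →
          (⟨IrrClass.comap (cmDatumLocalCongr L v T ha h).symm πn, some c⟩ : CMLocalAPacket L H v).CharIdentityAtTest L H v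
          (fun c' f => (if ∃ z : LocalRing L v, IsUnit z ∧ a = z * conjLocal L (IsCMField.complexConj L) v z then (1 : ℂ) else -1) *
          c'.smoothTrace (νG v) f)
          (ξ.xiLocalChar v) (νH v) (Δ v) (mH v) (mG v)

/-! ## §1 The socket statements (S-U), (S-G) — (O2♭)∕(O2♮) binders verbatim, arrows `hQS hns hK hn` named -/

/-- **(S-U) «SC-UNIQUE» `SocketScUnique`** (LH10-p02 (g19), desk sheet §2): at the (O2♮) binders, every SUPERCUSPIDAL `v`-constituent `c` of `P` (non-split `v`, Keys
labels `(π², πⁿ)`, `¬ πⁿ L²`) EQUALS `((hQS ξ).1 v hns T a ha h μZ π2 πn hK hn).πs` — the `πˢ(ξ_v) ∘ e` read off the SIGNED Q-package of record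
(★ `CMNonsplitCharIdentityAtTestSigned.πs`, a CHOICE; unique by ★ `F0P2oCharIdentityCompletionUniqueTest.eq_of_charIdentityAtTest` up to the sign transport).  Print:
`P ∈ Π′(ξ)` ⇒ `P_v ∈ Π(ξ_v) ∘ e = {πⁿ, πˢ}(ξ_v) ∘ e` [Thm. 13.3.6 (c) over §14.6], `πˢ(ξ_v)` the unique supercuspidal completing `πⁿ(ξ_v)` in (13.1.4) [Prop. 13.1.3 (d)].
⟹ (O2♮) (`xiPacketRigidCoreSc_of_scUnique`); ⟺ (S-G) over ★ (J1, J1⁻¹).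
[cite: Rogawski1990, §13.3 Thm. 13.3.6 (c) p. 202; §14.6 Thm. 14.6.1 p. 241, Thm. 14.6.4 p. 243; §13.1 Prop. 13.1.3 (d), Prop. 13.1.4 p. 199; §4.9 p. 55] [cite: LanglandsShelstad1987, §1] -/
def SocketScUnique : Prop :=
  ∀ (L : Type) [Field L] [NumberField L] [IsCMField L] (H : Matrix (Fin 3) (Fin 3) L)
    (hH : (H.map (cmConjRingHom L))ᵀ = H) (hHd : IsUnit H.det)
    [∀ v : HeightOneSpectrum (𝓞 ↥(maximalRealSubfield L)), MeasurableSpace ((cmDatum L 3 H).Local v)]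
    [∀ v : HeightOneSpectrum (𝓞 ↥(maximalRealSubfield L)),
      MeasurableSpace ((cmDatum L 2 (Matrix.of fun i j : Fin 2 => if i.val + j.val + 1 = 2 then (1 : L) else 0)).Local v ×
        (cmDatum L 1 (Matrix.of fun i j : Fin 1 => if i.val + j.val + 1 = 1 then (1 : L) else 0)).Local v)]
    [∀ (v : HeightOneSpectrum (𝓞 ↥(maximalRealSubfield L)))
        (a : ((cmDatum L 2 (Matrix.of fun i j : Fin 2 => if i.val + j.val + 1 = 2 then (1 : L) else 0)).Local v ×
          (cmDatum L 1 (Matrix.of fun i j : Fin 1 => if i.val + j.val + 1 = 1 then (1 : L) else 0)).Local v)),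
      MeasurableSpace (((cmDatum L 2 (Matrix.of fun i j : Fin 2 => if i.val + j.val + 1 = 2 then (1 : L) else 0)).Local v ×
          (cmDatum L 1 (Matrix.of fun i j : Fin 1 => if i.val + j.val + 1 = 1 then (1 : L) else 0)).Local v) ⧸
        Subgroup.centralizer ({a} : Set ((cmDatum L 2 (Matrix.of fun i j : Fin 2 => if i.val + j.val + 1 = 2 then (1 : L) else 0)).Local v ×
          (cmDatum L 1 (Matrix.of fun i j : Fin 1 => if i.val + j.val + 1 = 1 then (1 : L) else 0)).Local v)))]
    [∀ (v : HeightOneSpectrum (𝓞 ↥(maximalRealSubfield L))) (γ : (cmDatum L 3 H).Local v),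
      MeasurableSpace ((cmDatum L 3 H).Local v ⧸ Subgroup.centralizer ({γ} : Set ((cmDatum L 3 H).Local v)))]
    (Δ : ∀ v : HeightOneSpectrum (𝓞 ↥(maximalRealSubfield L)), LocalTransferFactor L H v)
    (mH : ∀ v : HeightOneSpectrum (𝓞 ↥(maximalRealSubfield L)),
      OrbitalMeasureFamily ((cmDatum L 2 (Matrix.of fun i j : Fin 2 => if i.val + j.val + 1 = 2 then (1 : L) else 0)).Local v ×
        (cmDatum L 1 (Matrix.of fun i j : Fin 1 => if i.val + j.val + 1 = 1 then (1 : L) else 0)).Local v))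
    (mG : ∀ v : HeightOneSpectrum (𝓞 ↥(maximalRealSubfield L)), OrbitalMeasureFamily ((cmDatum L 3 H).Local v))
    (νG : ∀ v : HeightOneSpectrum (𝓞 ↥(maximalRealSubfield L)), Measure ((cmDatum L 3 H).Local v))
    (νH : ∀ v : HeightOneSpectrum (𝓞 ↥(maximalRealSubfield L)),
      Measure ((cmDatum L 2 (Matrix.of fun i j : Fin 2 => if i.val + j.val + 1 = 2 then (1 : L) else 0)).Local v ×
        (cmDatum L 1 (Matrix.of fun i j : Fin 1 => if i.val + j.val + 1 = 1 then (1 : L) else 0)).Local v))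
    [∀ v : HeightOneSpectrum (𝓞 ↥(maximalRealSubfield L)), BorelSpace ((cmDatum L 3 H).Local v)]
    [∀ v : HeightOneSpectrum (𝓞 ↥(maximalRealSubfield L)),
      BorelSpace ((cmDatum L 2 (Matrix.of fun i j : Fin 2 => if i.val + j.val + 1 = 2 then (1 : L) else 0)).Local v ×
        (cmDatum L 1 (Matrix.of fun i j : Fin 1 => if i.val + j.val + 1 = 1 then (1 : L) else 0)).Local v)]
    [∀ (v : HeightOneSpectrum (𝓞 ↥(maximalRealSubfield L)))
        (a : ((cmDatum L 2 (Matrix.of fun i j : Fin 2 => if i.val + j.val + 1 = 2 then (1 : L) else 0)).Local v ×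
          (cmDatum L 1 (Matrix.of fun i j : Fin 1 => if i.val + j.val + 1 = 1 then (1 : L) else 0)).Local v)),
      BorelSpace (((cmDatum L 2 (Matrix.of fun i j : Fin 2 => if i.val + j.val + 1 = 2 then (1 : L) else 0)).Local v ×
          (cmDatum L 1 (Matrix.of fun i j : Fin 1 => if i.val + j.val + 1 = 1 then (1 : L) else 0)).Local v) ⧸
        Subgroup.centralizer ({a} : Set ((cmDatum L 2 (Matrix.of fun i j : Fin 2 => if i.val + j.val + 1 = 2 then (1 : L) else 0)).Local v ×
          (cmDatum L 1 (Matrix.of fun i j : Fin 1 => if i.val + j.val + 1 = 1 then (1 : L) else 0)).Local v)))]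
    [∀ (v : HeightOneSpectrum (𝓞 ↥(maximalRealSubfield L))) (γ : (cmDatum L 3 H).Local v),
      BorelSpace ((cmDatum L 3 H).Local v ⧸ Subgroup.centralizer ({γ} : Set ((cmDatum L 3 H).Local v)))]
    [∀ v, (νG v).IsHaarMeasure] [∀ v, (νG v).IsMulRightInvariant] [∀ v, (νH v).IsHaarMeasure] [∀ v, (νH v).IsMulRightInvariant],
    ∀ (μω : HeckeCharacter L) (hμu : μω.IsUnitary),
    (∀ x : Literature.NumberTheory.GaloisRepresentations.ideleGroup ↥(maximalRealSubfield L),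
      μω (AdeleRing.ideleBaseChange (↥(maximalRealSubfield L)) L x) = quadraticHeckeCharCM L x) →
    Δ = finExplicitCollection L H μω (finExplicitDelta_conj_left_all L H μω) (finExplicitDelta_conj_right_all L H μω) →
    (∀ v : HeightOneSpectrum (𝓞 ↥(maximalRealSubfield L)), (mH v).IsCanonical (IsLocalGRegular L v) (νH v) ∧
      (mG v).IsCanonical (fun γ => IsRegularElt (γ.val : GL (Fin 3) (UnitaryGroup.LocalRing L v))) (νG v)) →
    ∀ (hQS : CMCharIdentityPackageTestSigned L H hH hHd νH νG μω hμu Δ mH mG),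
    (∀ v : HeightOneSpectrum (𝓞 ↥(maximalRealSubfield L)), (∀ w : PlacesOver L v, IsCMField.complexConj L • w.1 = w.1) →
      IsLocalDeltaTransferExists L H v (Δ v) (mH v) (mG v) Literature.NumberTheory.Rogawski1990.IsLocSmooth
        Literature.NumberTheory.Rogawski1990.IsLocSmooth) →
    ∀ (ξ : OneDimAutRepH L)
      (μA : Measure (adelicGroupData (↥(maximalRealSubfield L)) L (IsCMField.complexConj L) 3 H).automorphicQuotient)
      [(adelicGroupData (↥(maximalRealSubfield L)) L (IsCMField.complexConj L) 3 H).IsAutomorphicMeasure μA]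
      (P : DiscreteAutomorphicRep (adelicGroupData (↥(maximalRealSubfield L)) L (IsCMField.complexConj L) 3 H) μA),
      MemXiFamily P hH hHd μω hμu ξ →
      ∀ (v : HeightOneSpectrum (𝓞 ↥(maximalRealSubfield L))) (hns : ∀ w : PlacesOver L v, IsCMField.complexConj L • w.1 = w.1),
      ∀ (T : GL (Fin 3) (LocalRing L v)) (a : LocalRing L v) (ha : IsUnit a)
        (h : formCongr (conjLocal L (IsCMField.complexConj L) v) T (H.map (algebraMap L (LocalRing L v))) =
          a • (Matrix.of fun i j : Fin 3 => if i.val + j.val + 1 = 3 then (1 : L) else 0).map (algebraMap L (LocalRing L v))),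
      ∀ [MeasurableSpace (Gqs L v ⧸ Subgroup.center (Gqs L v))] [BorelSpace (Gqs L v ⧸ Subgroup.center (Gqs L v))]
        (μZ : Measure (Gqs L v ⧸ Subgroup.center (Gqs L v))) [μZ.IsHaarMeasure],
      ∀ (π2 πn : IrrClass (Gqs L v)),
      ∀ (hK : KeysCaseTwoLabels L v (μω.semilocalComponent L v) (torusLocalComponent L (IsCMField.complexConj L) v ξ.η)
          (torusLocalComponent L (IsCMField.complexConj L) v ξ.ψ) π2 πn)
        (hn : ¬ πn.IsSquareIntegrable μZ),
        -- (S-U) «SC-UNIQUE»: every SUPERCUSPIDAL v-constituent of P IS the πˢ(ξ_v) ∘ e read off the SIGNED Q-package `hQS`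
        ∀ c : IrrClass ((cmDatum L 3 H).Local v),
          (IrrClass.comap (localPiEquiv L (IsCMField.complexConj L) 3 H v) c).IsConstituentOf
              (P.finRep.smoothPart.toRepresentation.comp (inclPlace (↥(maximalRealSubfield L)) L (IsCMField.complexConj L) 3 H v)) →
          c.IsSupercuspidal →
          c = ((hQS ξ).1 v hns T a ha h μZ π2 πn hK hn).πs

/-- **(S-G) «13.3.6 (c) ∕ §14.6 AT PRINT'S PINNED DATA» `SocketGlobalXiMembership`** — THE S9 SOCKET (desk sheet §2; SOCKET CENSUS v2 §S9): at the (O2♮) binders, every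
`v`-constituent `c` of a discrete `P` of `U(H)` with `MemXiFamily P hH hHd μω hμu ξ` (non-split `v`, Keys labels `(π², πⁿ)`, `¬ πⁿ L²`) is `πⁿ(ξ_v) ∘ e` OR `π²(ξ_v) ∘ e`
OR `((hQS ξ).1 v …).πs` — i.e. the ★ pin-free envelope trichotomy `F0P3cDbTEnvelopeTrichotomy.constituent_trichotomy_of_memXiFamily` («`πⁿ ∘ e` ∨ `π² ∘ e` ∨
supercuspidal», p848339) with its FREE supercuspidal slot PINNED to `πˢ(ξ_v)`.  Print (GLOBAL, trace-formula class): a discrete `P` of the inner form `U(H)` whose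
split components lie in the `ξ`-packets is in `Π′(ξ)` [§14.6 Thm. 14.6.1 ∕ 14.6.4 over §13.3 Thm. 13.3.6 (c), 13.3.5], so `P_v ∈ {πⁿ, πˢ}(ξ_v) ∘ e` at non-split `v`
[§12.2 (2), Prop. 13.1.3 (d)]; the `π² ∘ e` disjunct is print-vacuous but kept ((O2♭)'s clause (α) is not consumed by any head).  WEAKER than print only there.
PRINT ROAD (audits r564 N2 ∕ audit1 (b)): Thm. 13.3.5 + Thm. 13.3.6 (c) on the quasi-split `U(3)`, then §14.6 (Thm. 14.6.1 p. 241, Thm. 14.6.4 p. 243) for `U(H)`.  PAID (ED. 2) from FILE B's named sockets via its proved case split (quasi-split∕congruent-to-`b • Φ₃` case from S5's 13.3.6 (c) + transport; anisotropic∕definite case = the §14.6 print leaf).  NOT a local statement: no by-name bridge from LH7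
`PKrigidCoreLetter` or #75-loc (LH10-p01 (g22) digits (d1)(d2)).
[cite: Rogawski1990, §13.3 Thm. 13.3.5, Thm. 13.3.6 (c), Thm. 13.3.7 pp. 201–203; §14.6 Thm. 14.6.1 p. 241, Thm. 14.6.4 p. 243, p. 246; §12.2 (2) p. 174; §13.1 Prop. 13.1.3 (d), Prop. 13.1.4 p. 199; §14.2 p. 232] -/
def SocketGlobalXiMembership : Prop :=
  ∀ (L : Type) [Field L] [NumberField L] [IsCMField L] (H : Matrix (Fin 3) (Fin 3) L)
    (hH : (H.map (cmConjRingHom L))ᵀ = H) (hHd : IsUnit H.det)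
    [∀ v : HeightOneSpectrum (𝓞 ↥(maximalRealSubfield L)), MeasurableSpace ((cmDatum L 3 H).Local v)]
    [∀ v : HeightOneSpectrum (𝓞 ↥(maximalRealSubfield L)),
      MeasurableSpace ((cmDatum L 2 (Matrix.of fun i j : Fin 2 => if i.val + j.val + 1 = 2 then (1 : L) else 0)).Local v ×
        (cmDatum L 1 (Matrix.of fun i j : Fin 1 => if i.val + j.val + 1 = 1 then (1 : L) else 0)).Local v)]
    [∀ (v : HeightOneSpectrum (𝓞 ↥(maximalRealSubfield L)))
        (a : ((cmDatum L 2 (Matrix.of fun i j : Fin 2 => if i.val + j.val + 1 = 2 then (1 : L) else 0)).Local v ×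
          (cmDatum L 1 (Matrix.of fun i j : Fin 1 => if i.val + j.val + 1 = 1 then (1 : L) else 0)).Local v)),
      MeasurableSpace (((cmDatum L 2 (Matrix.of fun i j : Fin 2 => if i.val + j.val + 1 = 2 then (1 : L) else 0)).Local v ×
          (cmDatum L 1 (Matrix.of fun i j : Fin 1 => if i.val + j.val + 1 = 1 then (1 : L) else 0)).Local v) ⧸
        Subgroup.centralizer ({a} : Set ((cmDatum L 2 (Matrix.of fun i j : Fin 2 => if i.val + j.val + 1 = 2 then (1 : L) else 0)).Local v ×
          (cmDatum L 1 (Matrix.of fun i j : Fin 1 => if i.val + j.val + 1 = 1 then (1 : L) else 0)).Local v)))]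
    [∀ (v : HeightOneSpectrum (𝓞 ↥(maximalRealSubfield L))) (γ : (cmDatum L 3 H).Local v),
      MeasurableSpace ((cmDatum L 3 H).Local v ⧸ Subgroup.centralizer ({γ} : Set ((cmDatum L 3 H).Local v)))]
    (Δ : ∀ v : HeightOneSpectrum (𝓞 ↥(maximalRealSubfield L)), LocalTransferFactor L H v)
    (mH : ∀ v : HeightOneSpectrum (𝓞 ↥(maximalRealSubfield L)),
      OrbitalMeasureFamily ((cmDatum L 2 (Matrix.of fun i j : Fin 2 => if i.val + j.val + 1 = 2 then (1 : L) else 0)).Local v ×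
        (cmDatum L 1 (Matrix.of fun i j : Fin 1 => if i.val + j.val + 1 = 1 then (1 : L) else 0)).Local v))
    (mG : ∀ v : HeightOneSpectrum (𝓞 ↥(maximalRealSubfield L)), OrbitalMeasureFamily ((cmDatum L 3 H).Local v))
    (νG : ∀ v : HeightOneSpectrum (𝓞 ↥(maximalRealSubfield L)), Measure ((cmDatum L 3 H).Local v))
    (νH : ∀ v : HeightOneSpectrum (𝓞 ↥(maximalRealSubfield L)),
      Measure ((cmDatum L 2 (Matrix.of fun i j : Fin 2 => if i.val + j.val + 1 = 2 then (1 : L) else 0)).Local v ×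
        (cmDatum L 1 (Matrix.of fun i j : Fin 1 => if i.val + j.val + 1 = 1 then (1 : L) else 0)).Local v))
    [∀ v : HeightOneSpectrum (𝓞 ↥(maximalRealSubfield L)), BorelSpace ((cmDatum L 3 H).Local v)]
    [∀ v : HeightOneSpectrum (𝓞 ↥(maximalRealSubfield L)),
      BorelSpace ((cmDatum L 2 (Matrix.of fun i j : Fin 2 => if i.val + j.val + 1 = 2 then (1 : L) else 0)).Local v ×
        (cmDatum L 1 (Matrix.of fun i j : Fin 1 => if i.val + j.val + 1 = 1 then (1 : L) else 0)).Local v)]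
    [∀ (v : HeightOneSpectrum (𝓞 ↥(maximalRealSubfield L)))
        (a : ((cmDatum L 2 (Matrix.of fun i j : Fin 2 => if i.val + j.val + 1 = 2 then (1 : L) else 0)).Local v ×
          (cmDatum L 1 (Matrix.of fun i j : Fin 1 => if i.val + j.val + 1 = 1 then (1 : L) else 0)).Local v)),
      BorelSpace (((cmDatum L 2 (Matrix.of fun i j : Fin 2 => if i.val + j.val + 1 = 2 then (1 : L) else 0)).Local v ×
          (cmDatum L 1 (Matrix.of fun i j : Fin 1 => if i.val + j.val + 1 = 1 then (1 : L) else 0)).Local v) ⧸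
        Subgroup.centralizer ({a} : Set ((cmDatum L 2 (Matrix.of fun i j : Fin 2 => if i.val + j.val + 1 = 2 then (1 : L) else 0)).Local v ×
          (cmDatum L 1 (Matrix.of fun i j : Fin 1 => if i.val + j.val + 1 = 1 then (1 : L) else 0)).Local v)))]
    [∀ (v : HeightOneSpectrum (𝓞 ↥(maximalRealSubfield L))) (γ : (cmDatum L 3 H).Local v),
      BorelSpace ((cmDatum L 3 H).Local v ⧸ Subgroup.centralizer ({γ} : Set ((cmDatum L 3 H).Local v)))]
    [∀ v, (νG v).IsHaarMeasure] [∀ v, (νG v).IsMulRightInvariant] [∀ v, (νH v).IsHaarMeasure] [∀ v, (νH v).IsMulRightInvariant],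
    ∀ (μω : HeckeCharacter L) (hμu : μω.IsUnitary),
    (∀ x : Literature.NumberTheory.GaloisRepresentations.ideleGroup ↥(maximalRealSubfield L),
      μω (AdeleRing.ideleBaseChange (↥(maximalRealSubfield L)) L x) = quadraticHeckeCharCM L x) →
    Δ = finExplicitCollection L H μω (finExplicitDelta_conj_left_all L H μω) (finExplicitDelta_conj_right_all L H μω) →
    (∀ v : HeightOneSpectrum (𝓞 ↥(maximalRealSubfield L)), (mH v).IsCanonical (IsLocalGRegular L v) (νH v) ∧
      (mG v).IsCanonical (fun γ => IsRegularElt (γ.val : GL (Fin 3) (UnitaryGroup.LocalRing L v))) (νG v)) →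
    ∀ (hQS : CMCharIdentityPackageTestSigned L H hH hHd νH νG μω hμu Δ mH mG),
    (∀ v : HeightOneSpectrum (𝓞 ↥(maximalRealSubfield L)), (∀ w : PlacesOver L v, IsCMField.complexConj L • w.1 = w.1) →
      IsLocalDeltaTransferExists L H v (Δ v) (mH v) (mG v) Literature.NumberTheory.Rogawski1990.IsLocSmooth
        Literature.NumberTheory.Rogawski1990.IsLocSmooth) →
    ∀ (ξ : OneDimAutRepH L)
      (μA : Measure (adelicGroupData (↥(maximalRealSubfield L)) L (IsCMField.complexConj L) 3 H).automorphicQuotient)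
      [(adelicGroupData (↥(maximalRealSubfield L)) L (IsCMField.complexConj L) 3 H).IsAutomorphicMeasure μA]
      (P : DiscreteAutomorphicRep (adelicGroupData (↥(maximalRealSubfield L)) L (IsCMField.complexConj L) 3 H) μA),
      MemXiFamily P hH hHd μω hμu ξ →
      ∀ (v : HeightOneSpectrum (𝓞 ↥(maximalRealSubfield L))) (hns : ∀ w : PlacesOver L v, IsCMField.complexConj L • w.1 = w.1),
      ∀ (T : GL (Fin 3) (LocalRing L v)) (a : LocalRing L v) (ha : IsUnit a)
        (h : formCongr (conjLocal L (IsCMField.complexConj L) v) T (H.map (algebraMap L (LocalRing L v))) =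
          a • (Matrix.of fun i j : Fin 3 => if i.val + j.val + 1 = 3 then (1 : L) else 0).map (algebraMap L (LocalRing L v))),
      ∀ [MeasurableSpace (Gqs L v ⧸ Subgroup.center (Gqs L v))] [BorelSpace (Gqs L v ⧸ Subgroup.center (Gqs L v))]
        (μZ : Measure (Gqs L v ⧸ Subgroup.center (Gqs L v))) [μZ.IsHaarMeasure],
      ∀ (π2 πn : IrrClass (Gqs L v)),
      ∀ (hK : KeysCaseTwoLabels L v (μω.semilocalComponent L v) (torusLocalComponent L (IsCMField.complexConj L) v ξ.η)
          (torusLocalComponent L (IsCMField.complexConj L) v ξ.ψ) π2 πn)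
        (hn : ¬ πn.IsSquareIntegrable μZ),
        -- (S-G) «13.3.6 (c) ∕ §14.6 AT PRINT'S PINNED DATA»: every v-constituent of P is πⁿ ∘ e, π² ∘ e, or the πˢ(ξ_v) ∘ e of `hQS`
        ∀ c : IrrClass ((cmDatum L 3 H).Local v),
          (IrrClass.comap (localPiEquiv L (IsCMField.complexConj L) 3 H v) c).IsConstituentOf
              (P.finRep.smoothPart.toRepresentation.comp (inclPlace (↥(maximalRealSubfield L)) L (IsCMField.complexConj L) 3 H v)) →
          c = IrrClass.comap (cmDatumLocalCongr L v T ha h).symm πn ∨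
            c = IrrClass.comap (cmDatumLocalCongr L v T ha h).symm π2 ∨
            c = ((hQS ξ).1 v hns T a ha h μZ π2 πn hK hn).πs

/-! ## §2 THE NAMED SOCKET (ED. 2 «B-PAY»: PROVED from FILE B's paid head — no `sorry` in this file; name + statement frozen since ED. 1) -/

/-- **SOCKET `stub_globalXiMembership : SocketGlobalXiMembership`** — Rogawski's Thm. 13.3.6 (c) transported to the inner form `U(H)` by §14.6 (Thm. 14.6.1 ∕ 14.6.4),
at print's pinned data; PRINT, GLOBAL (stable trace formula + base change).  ED. 1: sorried.  ED. 2 «B-PAY»: PROVED from FILE B `R90_S9_InnerFormTransportB`'s paid head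
`xiMembershipAt_paidB : ∀ L … hHd, XiMembershipAt L H hH hHd` (itself resting on B's named `sock_S9_*` sockets) — the S9 debt moves BENEATH this name; nothing printed is
discharged.  Pays LH10 :423 via `xiPacketRigidCoreSc_paid` (byte-stable).
[cite: Rogawski1990, §13.3 Thm. 13.3.5, Thm. 13.3.6 (c) p. 202; §14.6 Thm. 14.6.1 p. 241, Thm. 14.6.4 p. 243, pp. 241–246; §13.1 Prop. 13.1.3 (d), Prop. 13.1.4 p. 199] -/
theorem stub_globalXiMembership : SocketGlobalXiMembership :=
  fun L _ _ _ H hH hHd => xiMembershipAt_paidB L H hH hHd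

/-- **JUNCTION B0 ↔ (S-G)** (LAW L9 (β)): this file's socket IS «`XiMembershipAt` at every CM field `L` and hermitian `H`» — by `Iff.rfl` (B0's body = the (S-G) body
:240–:307 with the first four binders as parameters; certified against ED. 1 in `CERT-B0-XiMembershipAt.lean` 3edf0ec5e434797a).  No sorry. -/
theorem globalXiMembership_iff_forall_at :
    SocketGlobalXiMembership ↔
      ∀ (L : Type) [Field L] [NumberField L] [IsCMField L] (H : Matrix (Fin 3) (Fin 3) L)
        (hH : (H.map (cmConjRingHom L))ᵀ = H) (hHd : IsUnit H.det), XiMembershipAt L H hH hHd :=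
  Iff.rfl

/-! ## §3 Junctions (PROVED, no sorry) -/

set_option synthInstance.maxHeartbeats 400000 in
set_option maxHeartbeats 8000000 in
/-- **J1 `(S-G) → (S-U)`**: at a SUPERCUSPIDAL constituent `c` the disjuncts `c = πⁿ ∘ e`, `c = π² ∘ e` are absurd (★ `F0P3cStCharTSNe.ne_comap_keysLabels_of_isSupercuspidal`:
a supercuspidal class is no constituent of `i_G(χ_ξ) ∘ e`), leaving `c = πˢ`.  No sorry. [cite: Rogawski1990, §12.2 (2) pp. 173–174; §12.7 Lemma 12.7.3 p. 195; §13.1 Prop. 13.1.3 (d) p. 199] -/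
theorem scUnique_of_globalXiMembership (hG : SocketGlobalXiMembership) : SocketScUnique := by
  intro L _ _ _ H hH hHd _ _ _ _ Δ mH mG νG νH _ _ _ _ _ _ _ _ μω hμu hμω hΔ hcan hQS hex ξ μA _ P hmem v hns T a ha h _ _ μZ _ π2 πn hK hn c hc hsc
  rcases hG L H hH hHd Δ mH mG νG νH μω hμu hμω hΔ hcan hQS hex ξ μA P hmem v hns T a ha h μZ π2 πn hK hn c hc with hπn | hπ2 | hπs
  · exact absurd hπn (F0P3cStCharTSNe.ne_comap_keysLabels_of_isSupercuspidal L H v hns T a ha h (μω.semilocalComponent L v)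
      (torusLocalComponent L (IsCMField.complexConj L) v ξ.η) (torusLocalComponent L (IsCMField.complexConj L) v ξ.ψ) π2 πn hK c hsc).1
  · exact absurd hπ2 (F0P3cStCharTSNe.ne_comap_keysLabels_of_isSupercuspidal L H v hns T a ha h (μω.semilocalComponent L v)
      (torusLocalComponent L (IsCMField.complexConj L) v ξ.η) (torusLocalComponent L (IsCMField.complexConj L) v ξ.ψ) π2 πn hK c hsc).2
  · exact hπs

set_option synthInstance.maxHeartbeats 400000 in
set_option maxHeartbeats 8000000 in
/-- **J1⁻¹ `(S-U) → (S-G)`**: the ★ pin-free envelope trichotomy `F0P3cDbTEnvelopeTrichotomy.constituent_trichotomy_of_memXiFamily` (p848339) gives `πⁿ ∘ e` ∨ `π² ∘ e` ∨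
supercuspidal; (S-U) pins the third.  Certifies (S-G) ⟺ (S-U) over ★ (the socket adds to the tree EXACTLY the supercuspidal pin).  No sorry.
[cite: Rogawski1990, §13.3 Thm. 13.3.6 (c) p. 202; §12.2 (2) p. 174; §13.1 Prop. 13.1.3 (d) p. 199] -/
theorem globalXiMembership_of_scUnique (hU : SocketScUnique) : SocketGlobalXiMembership := by
  intro L _ _ _ H hH hHd _ _ _ _ Δ mH mG νG νH _ _ _ _ _ _ _ _ μω hμu hμω hΔ hcan hQS hex ξ μA _ P hmem v hns T a ha h _ _ μZ _ π2 πn hK hn c hc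
  rcases F0P3cDbTEnvelopeTrichotomy.constituent_trichotomy_of_memXiFamily L H hH hHd μω hμu ξ P hmem v hns T a ha h π2 πn hK c hc with hπn | hπ2 | hsc
  · exact Or.inl hπn
  · exact Or.inr (Or.inl hπ2)
  · exact Or.inr (Or.inr (hU L H hH hHd Δ mH mG νG νH μω hμu hμω hΔ hcan hQS hex ξ μA P hmem v hns T a ha h μZ π2 πn hK hn c hc hsc))

open scoped Classical in
set_option synthInstance.maxHeartbeats 400000 in
set_option maxHeartbeats 8000000 in
/-- **J2 `(S-U) → TopXiPacketRigidCoreSc` (= O2♮)**: substitute `c = πˢ` and read the SIGNED (13.1.4) on test functions off the Q-package of record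
(★ `CMNonsplitCharIdentityAtTestSigned.charIdentityAtTestSigned_πs`, member traces `ε_v(H) · Tr π(f dν_G)`, `ε_v(H) = if ∃ z, IsUnit z ∧ a = z·σ(z) then 1 else −1`).  No sorry.
[cite: Rogawski1990, §13.1 Prop. 13.1.4 p. 199; §4.9 p. 55; §14.6 p. 242] [cite: LanglandsShelstad1987, §1] -/
theorem xiPacketRigidCoreSc_of_scUnique (hU : SocketScUnique) : TopXiPacketRigidCoreSc := by
  intro L _ _ _ H hH hHd _ _ _ _ Δ mH mG νG νH _ _ _ _ _ _ _ _ μω hμu hμω hΔ hcan hQS hex ξ μA _ P hmem v hns T a ha h _ _ μZ _ π2 πn hK hn c hc hsc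
  obtain rfl := hU L H hH hHd Δ mH mG νG νH μω hμu hμω hΔ hcan hQS hex ξ μA P hmem v hns T a ha h μZ π2 πn hK hn c hc hsc
  exact ((hQS ξ).1 v hns T a ha h μZ π2 πn hK hn).charIdentityAtTestSigned_πs

/-- **HEAD `(S-G) → TopXiPacketRigidCoreSc`** — the junction «S9 socket → LH10 leaf» (J2 ∘ J1), kernel-checked, no sorry.  The architect's index states the LH10 S-layer
target from sockets by THIS name. [cite: Rogawski1990, §13.3 Thm. 13.3.6 (c) p. 202; §14.6 Thm. 14.6.1 p. 241, Thm. 14.6.4 p. 243; §13.1 Prop. 13.1.4 p. 199] -/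
theorem xiPacketRigidCoreSc_of_globalXiMembership (hG : SocketGlobalXiMembership) : TopXiPacketRigidCoreSc :=
  xiPacketRigidCoreSc_of_scUnique (scUnique_of_globalXiMembership hG)

/-- **PAID HEAD `xiPacketRigidCoreSc_paid : TopXiPacketRigidCoreSc`** — the TOP from the NAMED socket `stub_globalXiMembership` (ED. 2: sorry-dependent ONLY through
FILE B's named `sock_S9_*` sockets).  PAY LINE for the LH10 leaf (byte-stable across editions): `theorem stub_xiPacketRigidCoreSc : StubXiPacketRigidCoreSc := R90.S9.xiPacketRigidCoreSc_paid` (δ-unfolding of two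
byte-identical `def`s).  [cite: Rogawski1990, §13.3 Thm. 13.3.6 (c) p. 202; §14.6 Thm. 14.6.4 p. 243] -/
theorem xiPacketRigidCoreSc_paid : TopXiPacketRigidCoreSc :=
  xiPacketRigidCoreSc_of_globalXiMembership stub_globalXiMembership

/-! ## §4 Junction J3 and the ⟺ certificates (ED. 3 «J3»; text by R90-IF-p03 (g0), cand 602e30561d1e0418, over ★ p861411
`Theorems/R90S9PisEqOfCharIdentityAtTestSigned` — signed completion uniqueness [Prop. 13.1.3 (d)]; closes (O2♮) ⟺ (S-U) ⟺ (S-G) over ★; no sorry) -/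

open scoped Classical in
set_option synthInstance.maxHeartbeats 400000 in
set_option maxHeartbeats 8000000 in
/-- **J3 `TopXiPacketRigidCoreSc → (S-U)`** (the converse of J2): at a SUPERCUSPIDAL constituent `c`, (O2♮) gives the SIGNED (13.1.4) on test functions for `⟨πⁿ ∘ e, some c⟩`;
signed completion uniqueness under (H₇) (★ `R90.S9.eq_packagePis_of_charIdentityAtTestSigned`, [Prop. 13.1.3 (d)]) pins `c` to `((hQS ξ).1 v …).πs`.  No sorry.
[cite: Rogawski1990, §13.1 Prop. 13.1.3 (d), Prop. 13.1.4 p. 199; §4.9 Prop. 4.9.1 (a) p. 55; §14.6 p. 242] [cite: LanglandsShelstad1987, §1] -/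
theorem scUnique_of_xiPacketRigidCoreSc (hT : TopXiPacketRigidCoreSc) : SocketScUnique := by
  intro L _ _ _ H hH hHd _ _ _ _ Δ mH mG νG νH _ _ _ _ _ _ _ _ μω hμu hμω hΔ hcan hQS hex ξ μA _ P hmem v hns T a ha h _ _ μZ _ π2 πn hK hn c hc hsc
  exact eq_packagePis_of_charIdentityAtTestSigned L H hH hHd νG hQS ξ v hns (hex v hns) T a ha h μZ π2 πn hK hn
    (hT L H hH hHd Δ mH mG νG νH μω hμu hμω hΔ hcan hQS hex ξ μA P hmem v hns T a ha h μZ π2 πn hK hn c hc hsc)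

/-- **`TopXiPacketRigidCoreSc ↔ SocketScUnique`** — (O2♮) ⟺ (S-U) over ★ (J3, J2). No sorry. [cite: Rogawski1990, §13.1 Prop. 13.1.3 (d), Prop. 13.1.4 p. 199] -/
theorem xiPacketRigidCoreSc_iff_scUnique : TopXiPacketRigidCoreSc ↔ SocketScUnique :=
  ⟨scUnique_of_xiPacketRigidCoreSc, xiPacketRigidCoreSc_of_scUnique⟩

/-- **`TopXiPacketRigidCoreSc ↔ SocketGlobalXiMembership`** — (O2♮) ⟺ (S-G) over ★ (J3 + J1⁻¹, HEAD). No sorry.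
[cite: Rogawski1990, §13.3 Thm. 13.3.6 (c) p. 202; §13.1 Prop. 13.1.3 (d), Prop. 13.1.4 p. 199] -/
theorem xiPacketRigidCoreSc_iff_globalXiMembership : TopXiPacketRigidCoreSc ↔ SocketGlobalXiMembership :=
  ⟨fun hT => globalXiMembership_of_scUnique (scUnique_of_xiPacketRigidCoreSc hT), xiPacketRigidCoreSc_of_globalXiMembership⟩

/-! ## §5 ED. 4-pre «FRAMED-KIT SOCKETS» — the S9-J7 statements at the letter's frame and kit, framed junctions -/

/-! ## §5.1 The framed-kit statements (A side; S9-J7 ∕ RULING S9-R-K (2) + S9-R-K-2) -/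

open scoped Classical in
set_option synthInstance.maxHeartbeats 400000 in
set_option maxHeartbeats 8000000 in
/-- **(O2♮-K) `TopXiPacketRigidCoreScFramedKit`** — the LH10 leaf's (O2♮) AT THE LETTER'S FRAME AND KIT (S9-R-K (2); the J7 target of LH10-plan): consumer telescope (`F0_P3c_PKtuplePaydown` ED. 6 ORGAN 1 `PKtupleBaseLetterK2μ` :91–:120, :124–:163) VERBATIM + SEAM 1 + the LH10 letter (H₇) `hex` + `(ξ P hsph)`, then ED. 3 `TopXiPacketRigidCoreSc` :146–:165 under σ. [cite: Rogawski1990, §13.3 Thm. 13.3.6 (c) p. 202; §13.1 Prop. 13.1.4 p. 199; §14.6 pp. 241–246] -/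
def TopXiPacketRigidCoreScFramedKit : Prop :=
  ∀ (L : Type) [Field L] [NumberField L] [IsCMField L] (ι : L →+* ℂ) (H : Matrix (Fin 3) (Fin 3) L) (T : GL (Fin 3) ℂ)
  (hT : (T : Matrix (Fin 3) (Fin 3) ℂ)ᴴ * H.map ι * (T : Matrix (Fin 3) (Fin 3) ℂ) = Literature.Geometry.ComplexHyperbolic.BallModel.J)
  (hdef : ∀ τ' : L →+* ℂ, InfinitePlace.mk τ' ≠ InfinitePlace.mk ι → (H.map τ').PosDef) (h2 : 2 ≤ Module.finrank ℚ ↥(maximalRealSubfield L))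
  (μ : Measure (Gp L H).automorphicQuotient) [(Gp L H).IsAutomorphicMeasure μ] (μω : HeckeCharacter L) (hμu : μω.IsUnitary)
  (hμω : ∀ x : Literature.NumberTheory.GaloisRepresentations.ideleGroup ↥(maximalRealSubfield L), μω (AdeleRing.ideleBaseChange (↥(maximalRealSubfield L)) L x) = quadraticHeckeCharCM L x)
  (ν : @Measure (GpAdelic L H) (borel _))
  (νH : ∀ v : Places L, @Measure (HLocal L v) (borel _)) (νG : ∀ v : Places L, @Measure (GpLocal L H v) (borel _))
  (νGi : @Measure (GpInf L H) (borel _)) (νqi : @Measure (GInf L) (borel _)) (νHi : @Measure (HInf L) (borel _))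
  (μZ : ∀ v : Places L, @Measure (Gqs L v ⧸ Subgroup.center (Gqs L v)) (borel _))
  (isHaar_ν : letI : MeasurableSpace (GpAdelic L H) := borel _; ν.IsHaarMeasure)
  (isInvInv_ν : letI : MeasurableSpace (GpAdelic L H) := borel _; ν.IsInvInvariant)
  (isHaar_νH : ∀ v : Places L, letI : MeasurableSpace (HLocal L v) := borel _; (νH v).IsHaarMeasure)
  (isRightInv_νH : ∀ v : Places L, letI : MeasurableSpace (HLocal L v) := borel _; (νH v).IsMulRightInvariant)
  (isHaar_νG : ∀ v : Places L, letI : MeasurableSpace (GpLocal L H v) := borel _; (νG v).IsHaarMeasure)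
  (isRightInv_νG : ∀ v : Places L, letI : MeasurableSpace (GpLocal L H v) := borel _; (νG v).IsMulRightInvariant)
  (finCpt_νGi : letI : MeasurableSpace (GpInf L H) := borel _; IsFiniteMeasureOnCompacts νGi)
  (rightInv_νGi : letI : MeasurableSpace (GpInf L H) := borel _; νGi.IsMulRightInvariant)
  (finCpt_νqi : letI : MeasurableSpace (GInf L) := borel _; IsFiniteMeasureOnCompacts νqi)
  (rightInv_νqi : letI : MeasurableSpace (GInf L) := borel _; νqi.IsMulRightInvariant)
  (finCpt_νHi : letI : MeasurableSpace (HInf L) := borel _; IsFiniteMeasureOnCompacts νHi)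
  (rightInv_νHi : letI : MeasurableSpace (HInf L) := borel _; νHi.IsMulRightInvariant)
  (isHaar_μZ : ∀ v : Places L, letI : MeasurableSpace (Gqs L v ⧸ Subgroup.center (Gqs L v)) := borel _; (μZ v).IsHaarMeasure)
  (hquad : ∀ v : Places L, (∀ w : PlacesOver L v, IsCMField.complexConj L • w.1 = w.1) →
    IsQuadraticCharExtension (conjLocal L (IsCMField.complexConj L) v) (μω.semilocalComponent L v))
  -- binders 33∕34: `vol_{νG_v}(K′_v) = 1` = `Rung0WitnessS.hK`, `vol_{νH_v}(K_{2,v} × K_{1,v}) = 1` = `Rung0WitnessS.hKH` (desk D35 (11)–(13); PROBE v7 :95–:99 VERBATIM)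
  (hvol : ∀ v : Places L, νG v (cmLocalIntegralLevel L 3 H v : Set (GpLocal L H v)) = 1)
  (hvolH : ∀ v : Places L,
    νH v (((cmLocalIntegralLevel L 2 (Matrix.of fun i j : Fin 2 => if i.val + j.val + 1 = 2 then (1 : L) else 0) v).prod
        (cmLocalIntegralLevel L 1 (Matrix.of fun i j : Fin 1 => if i.val + j.val + 1 = 1 then (1 : L) else 0) v) :
          Subgroup (HLocal L v)) : Set (HLocal L v)) = 1),
    -- SEAM 1 (S9-typ1 (g2) 22:17Z; import-free form, ★ `R90S8ResidualDefs` idiom): the kit ∕ `cmDatum`-keyed tokens below read the `Gp`-keyed automorphic-measure instance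
    haveI : (cmDatum L 3 H).IsAutomorphicMeasure μ := ‹(Gp L H).IsAutomorphicMeasure μ›
    letI : ∀ (v : Places L) (a : HLocal L v), MeasurableSpace (HLocal L v ⧸ Subgroup.centralizer ({a} : Set (HLocal L v))) := fun _ _ => borel _
    letI : ∀ (v : Places L) (γ : (cmDatum L 3 H).Local v),
        MeasurableSpace ((cmDatum L 3 H).Local v ⧸ Subgroup.centralizer ({γ} : Set ((cmDatum L 3 H).Local v))) := fun _ _ => borel _
    haveI : ∀ (v : Places L) (a : HLocal L v), BorelSpace (HLocal L v ⧸ Subgroup.centralizer ({a} : Set (HLocal L v))) := fun _ _ => ⟨rfl⟩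
    haveI : ∀ (v : Places L) (γ : (cmDatum L 3 H).Local v),
        BorelSpace ((cmDatum L 3 H).Local v ⧸ Subgroup.centralizer ({γ} : Set ((cmDatum L 3 H).Local v))) := fun _ _ => ⟨rfl⟩
    -- the K9 inner prefix of ★ `K9SpectralLetterSigned` (Defs :1402–:1447) VERBATIM, `hpin` NAMED
    ∀ (mH : ∀ v : Places L, OrbitalMeasureFamily (HLocal L v)) (mG : ∀ v : Places L, OrbitalMeasureFamily ((cmDatum L 3 H).Local v)),
      letI : MeasurableSpace (GpAdelic L H) := borel _
      haveI : BorelSpace (GpAdelic L H) := ⟨rfl⟩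
      haveI : ν.IsHaarMeasure := isHaar_ν
      haveI : ν.IsInvInvariant := isInvInv_ν
      letI : ∀ v : Places L, MeasurableSpace (GpLocal L H v) := fun _ => borel _
      haveI : ∀ v : Places L, BorelSpace (GpLocal L H v) := fun _ => ⟨rfl⟩
      letI : ∀ v : Places L, MeasurableSpace (HLocal L v) := fun _ => borel _
      haveI : ∀ v : Places L, BorelSpace (HLocal L v) := fun _ => ⟨rfl⟩
      letI : ∀ (v : Places L) (a : HLocal L v), MeasurableSpace (HLocal L v ⧸ Subgroup.centralizer ({a} : Set (HLocal L v))) := fun _ _ => borel _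
      letI : ∀ (v : Places L) (γ : GpLocal L H v), MeasurableSpace (GpLocal L H v ⧸ Subgroup.centralizer ({γ} : Set (GpLocal L H v))) := fun _ _ => borel _
      letI : MeasurableSpace (GpInf L H) := borel _
      haveI : BorelSpace (GpInf L H) := ⟨rfl⟩
      letI : MeasurableSpace (GInf L) := borel _
      haveI : BorelSpace (GInf L) := ⟨rfl⟩
      letI : MeasurableSpace (HInf L) := borel _
      haveI : BorelSpace (HInf L) := ⟨rfl⟩
      haveI : ∀ v : Places L, (νH v).IsHaarMeasure := isHaar_νH
      haveI : ∀ v : Places L, (νH v).IsMulRightInvariant := isRightInv_νH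
      haveI : ∀ v : Places L, (νG v).IsHaarMeasure := isHaar_νG
      haveI : ∀ v : Places L, (νG v).IsMulRightInvariant := isRightInv_νG
      haveI : IsFiniteMeasureOnCompacts νGi := finCpt_νGi
      haveI : νGi.IsMulRightInvariant := rightInv_νGi
      haveI : IsFiniteMeasureOnCompacts νqi := finCpt_νqi
      haveI : νqi.IsMulRightInvariant := rightInv_νqi
      haveI : IsFiniteMeasureOnCompacts νHi := finCpt_νHi
      haveI : νHi.IsMulRightInvariant := rightInv_νHi
      (∀ v : Places L, (mH v).IsCanonical (IsLocalGRegular L v) (νH v) ∧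
          (mG v).IsCanonical (fun γ => IsRegularElt (γ.val : GL (Fin 3) (UnitaryGroup.LocalRing L v))) (νG v)) →
      ∀ (𝔨 : ComparisonKit L H μ) (hpin : 𝔨.IsPinned ν (archCanonicalTransferFactor L H μω) νH νG νGi νqi νHi), 𝔨.TransferExistence → 𝔨.SimpleTraceFormula → 𝔨.Δ = (finExplicitCollection L H μω (finExplicitDelta_conj_left_all L H μω) (finExplicitDelta_conj_right_all L H μω)) → 𝔨.mH = mH →
        (∀ (v : Places L) (c' : ConjClasses ((cmDatum L 3 H).Local v)),
          Literature.NumberTheory.Rogawski1990.IsRegularElt ((Quotient.out c').val : GL (Fin 3) (UnitaryGroup.LocalRing L v)) → 𝔨.mG v c' = mG v c') →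
        ∀ (hQ : CMCharIdentityPackageTestSigned L H (transpose_map_cmConjRingHom_eq_of_frame L ι H T hT) (isUnit_det_of_frame L ι H T hT) νH νG μω hμu (finExplicitCollection L H μω (finExplicitDelta_conj_left_all L H μω) (finExplicitDelta_conj_right_all L H μω)) mH mG),
          -- (H₇) LOCAL Δ‴-TRANSFER EXISTENCE AT NON-SPLIT `v` — the ONE hypothesis beyond the consumer telescope, in LH10 `DbTSAtRecordW1`'s `hex` bytes under σ (= A ED. 3 :139–:141 = B ED. 3 :473–:475;
          -- ★ predicate `IsLocalDeltaTransferExists` of ★ `Literature…Rogawski1990.LocalTransferExistence`). NOTE: the consumer's `hΔ` (:160) is the kit pin `𝔨.Δ = Δ‴`, NOT this letter;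
          -- `F0_P3c_PKtuplePaydown` ED. 6 carries no local-transfer-existence clause in its telescope (grep count 0), so (H₇) cannot be «bound by name» there — J7 pays it from LH10's `hex`.
          (∀ v : HeightOneSpectrum (𝓞 ↥(maximalRealSubfield L)), (∀ w : PlacesOver L v, IsCMField.complexConj L • w.1 = w.1) →
            IsLocalDeltaTransferExists L H v (finExplicitCollection L H μω (finExplicitDelta_conj_left_all L H μω) (finExplicitDelta_conj_right_all L H μω) v) (mH v) (mG v) Literature.NumberTheory.Rogawski1990.IsLocSmooth
              Literature.NumberTheory.Rogawski1990.IsLocSmooth) →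
          -- S9 PART (S9-R-K (2)): print's `ξ`, a discrete `P` of `U(H)` FIXED BY `K^c = ∏_{v∈S₀} K_v` (★ `IsKcSpherical`, p862338), then the ED. 3 tail under σ
          ∀ (ξ : OneDimAutRepH L) (P : DiscreteAutomorphicRep (Gp L H) μ) (hsph : IsKcSpherical L ι H T hT μ P),
          MemXiFamily P (transpose_map_cmConjRingHom_eq_of_frame L ι H T hT) (isUnit_det_of_frame L ι H T hT) μω hμu ξ →
          ∀ (v : HeightOneSpectrum (𝓞 ↥(maximalRealSubfield L))), (∀ w : PlacesOver L v, IsCMField.complexConj L • w.1 = w.1) →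
          ∀ (T : GL (Fin 3) (LocalRing L v)) (a : LocalRing L v) (ha : IsUnit a)
            (h : formCongr (conjLocal L (IsCMField.complexConj L) v) T (H.map (algebraMap L (LocalRing L v))) =
              a • (Matrix.of fun i j : Fin 3 => if i.val + j.val + 1 = 3 then (1 : L) else 0).map (algebraMap L (LocalRing L v))),
          ∀ [MeasurableSpace (Gqs L v ⧸ Subgroup.center (Gqs L v))] [BorelSpace (Gqs L v ⧸ Subgroup.center (Gqs L v))]
            (μZ : Measure (Gqs L v ⧸ Subgroup.center (Gqs L v))) [μZ.IsHaarMeasure],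
          ∀ (π2 πn : IrrClass (Gqs L v)),
            KeysCaseTwoLabels L v (μω.semilocalComponent L v) (torusLocalComponent L (IsCMField.complexConj L) v ξ.η)
              (torusLocalComponent L (IsCMField.complexConj L) v ξ.ψ) π2 πn →
            ¬ πn.IsSquareIntegrable μZ →
            -- (β) «every SUPERCUSPIDAL v-constituent of P completes πⁿ ∘ e in the SIGNED (13.1.4) on test functions»
            ∀ c : IrrClass ((cmDatum L 3 H).Local v),
              (IrrClass.comap (localPiEquiv L (IsCMField.complexConj L) 3 H v) c).IsConstituentOf
                  (P.finRep.smoothPart.toRepresentation.comp (inclPlace (↥(maximalRealSubfield L)) L (IsCMField.complexConj L) 3 H v)) →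
              c.IsSupercuspidal →
              (⟨IrrClass.comap (cmDatumLocalCongr L v T ha h).symm πn, some c⟩ : CMLocalAPacket L H v).CharIdentityAtTest L H v
              (fun c' f => (if ∃ z : LocalRing L v, IsUnit z ∧ a = z * conjLocal L (IsCMField.complexConj L) v z then (1 : ℂ) else -1) *
              c'.smoothTrace (νG v) f)
              (ξ.xiLocalChar v) (νH v) (finExplicitCollection L H μω (finExplicitDelta_conj_left_all L H μω) (finExplicitDelta_conj_right_all L H μω) v) (mH v) (mG v)

open scoped Classical in
set_option synthInstance.maxHeartbeats 400000 in
set_option maxHeartbeats 8000000 in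
/-- **(S-U-K) `SocketScUniqueFramedKit`** — «SC-UNIQUE» at the frame and kit: same telescope, then ED. 3 `SocketScUnique` :228–:244 under σ. [cite: Rogawski1990, §13.1 Prop. 13.1.3 (d) p. 199; §12.2 (2) p. 174] -/
def SocketScUniqueFramedKit : Prop :=
  ∀ (L : Type) [Field L] [NumberField L] [IsCMField L] (ι : L →+* ℂ) (H : Matrix (Fin 3) (Fin 3) L) (T : GL (Fin 3) ℂ)
  (hT : (T : Matrix (Fin 3) (Fin 3) ℂ)ᴴ * H.map ι * (T : Matrix (Fin 3) (Fin 3) ℂ) = Literature.Geometry.ComplexHyperbolic.BallModel.J)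
  (hdef : ∀ τ' : L →+* ℂ, InfinitePlace.mk τ' ≠ InfinitePlace.mk ι → (H.map τ').PosDef) (h2 : 2 ≤ Module.finrank ℚ ↥(maximalRealSubfield L))
  (μ : Measure (Gp L H).automorphicQuotient) [(Gp L H).IsAutomorphicMeasure μ] (μω : HeckeCharacter L) (hμu : μω.IsUnitary)
  (hμω : ∀ x : Literature.NumberTheory.GaloisRepresentations.ideleGroup ↥(maximalRealSubfield L), μω (AdeleRing.ideleBaseChange (↥(maximalRealSubfield L)) L x) = quadraticHeckeCharCM L x)
  (ν : @Measure (GpAdelic L H) (borel _))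
  (νH : ∀ v : Places L, @Measure (HLocal L v) (borel _)) (νG : ∀ v : Places L, @Measure (GpLocal L H v) (borel _))
  (νGi : @Measure (GpInf L H) (borel _)) (νqi : @Measure (GInf L) (borel _)) (νHi : @Measure (HInf L) (borel _))
  (μZ : ∀ v : Places L, @Measure (Gqs L v ⧸ Subgroup.center (Gqs L v)) (borel _))
  (isHaar_ν : letI : MeasurableSpace (GpAdelic L H) := borel _; ν.IsHaarMeasure)
  (isInvInv_ν : letI : MeasurableSpace (GpAdelic L H) := borel _; ν.IsInvInvariant)
  (isHaar_νH : ∀ v : Places L, letI : MeasurableSpace (HLocal L v) := borel _; (νH v).IsHaarMeasure)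
  (isRightInv_νH : ∀ v : Places L, letI : MeasurableSpace (HLocal L v) := borel _; (νH v).IsMulRightInvariant)
  (isHaar_νG : ∀ v : Places L, letI : MeasurableSpace (GpLocal L H v) := borel _; (νG v).IsHaarMeasure)
  (isRightInv_νG : ∀ v : Places L, letI : MeasurableSpace (GpLocal L H v) := borel _; (νG v).IsMulRightInvariant)
  (finCpt_νGi : letI : MeasurableSpace (GpInf L H) := borel _; IsFiniteMeasureOnCompacts νGi)
  (rightInv_νGi : letI : MeasurableSpace (GpInf L H) := borel _; νGi.IsMulRightInvariant)
  (finCpt_νqi : letI : MeasurableSpace (GInf L) := borel _; IsFiniteMeasureOnCompacts νqi)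
  (rightInv_νqi : letI : MeasurableSpace (GInf L) := borel _; νqi.IsMulRightInvariant)
  (finCpt_νHi : letI : MeasurableSpace (HInf L) := borel _; IsFiniteMeasureOnCompacts νHi)
  (rightInv_νHi : letI : MeasurableSpace (HInf L) := borel _; νHi.IsMulRightInvariant)
  (isHaar_μZ : ∀ v : Places L, letI : MeasurableSpace (Gqs L v ⧸ Subgroup.center (Gqs L v)) := borel _; (μZ v).IsHaarMeasure)
  (hquad : ∀ v : Places L, (∀ w : PlacesOver L v, IsCMField.complexConj L • w.1 = w.1) →
    IsQuadraticCharExtension (conjLocal L (IsCMField.complexConj L) v) (μω.semilocalComponent L v))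
  -- binders 33∕34: `vol_{νG_v}(K′_v) = 1` = `Rung0WitnessS.hK`, `vol_{νH_v}(K_{2,v} × K_{1,v}) = 1` = `Rung0WitnessS.hKH` (desk D35 (11)–(13); PROBE v7 :95–:99 VERBATIM)
  (hvol : ∀ v : Places L, νG v (cmLocalIntegralLevel L 3 H v : Set (GpLocal L H v)) = 1)
  (hvolH : ∀ v : Places L,
    νH v (((cmLocalIntegralLevel L 2 (Matrix.of fun i j : Fin 2 => if i.val + j.val + 1 = 2 then (1 : L) else 0) v).prod
        (cmLocalIntegralLevel L 1 (Matrix.of fun i j : Fin 1 => if i.val + j.val + 1 = 1 then (1 : L) else 0) v) :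
          Subgroup (HLocal L v)) : Set (HLocal L v)) = 1),
    -- SEAM 1 (S9-typ1 (g2) 22:17Z; import-free form, ★ `R90S8ResidualDefs` idiom): the kit ∕ `cmDatum`-keyed tokens below read the `Gp`-keyed automorphic-measure instance
    haveI : (cmDatum L 3 H).IsAutomorphicMeasure μ := ‹(Gp L H).IsAutomorphicMeasure μ›
    letI : ∀ (v : Places L) (a : HLocal L v), MeasurableSpace (HLocal L v ⧸ Subgroup.centralizer ({a} : Set (HLocal L v))) := fun _ _ => borel _
    letI : ∀ (v : Places L) (γ : (cmDatum L 3 H).Local v),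
        MeasurableSpace ((cmDatum L 3 H).Local v ⧸ Subgroup.centralizer ({γ} : Set ((cmDatum L 3 H).Local v))) := fun _ _ => borel _
    haveI : ∀ (v : Places L) (a : HLocal L v), BorelSpace (HLocal L v ⧸ Subgroup.centralizer ({a} : Set (HLocal L v))) := fun _ _ => ⟨rfl⟩
    haveI : ∀ (v : Places L) (γ : (cmDatum L 3 H).Local v),
        BorelSpace ((cmDatum L 3 H).Local v ⧸ Subgroup.centralizer ({γ} : Set ((cmDatum L 3 H).Local v))) := fun _ _ => ⟨rfl⟩
    -- the K9 inner prefix of ★ `K9SpectralLetterSigned` (Defs :1402–:1447) VERBATIM, `hpin` NAMED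
    ∀ (mH : ∀ v : Places L, OrbitalMeasureFamily (HLocal L v)) (mG : ∀ v : Places L, OrbitalMeasureFamily ((cmDatum L 3 H).Local v)),
      letI : MeasurableSpace (GpAdelic L H) := borel _
      haveI : BorelSpace (GpAdelic L H) := ⟨rfl⟩
      haveI : ν.IsHaarMeasure := isHaar_ν
      haveI : ν.IsInvInvariant := isInvInv_ν
      letI : ∀ v : Places L, MeasurableSpace (GpLocal L H v) := fun _ => borel _
      haveI : ∀ v : Places L, BorelSpace (GpLocal L H v) := fun _ => ⟨rfl⟩
      letI : ∀ v : Places L, MeasurableSpace (HLocal L v) := fun _ => borel _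
      haveI : ∀ v : Places L, BorelSpace (HLocal L v) := fun _ => ⟨rfl⟩
      letI : ∀ (v : Places L) (a : HLocal L v), MeasurableSpace (HLocal L v ⧸ Subgroup.centralizer ({a} : Set (HLocal L v))) := fun _ _ => borel _
      letI : ∀ (v : Places L) (γ : GpLocal L H v), MeasurableSpace (GpLocal L H v ⧸ Subgroup.centralizer ({γ} : Set (GpLocal L H v))) := fun _ _ => borel _
      letI : MeasurableSpace (GpInf L H) := borel _
      haveI : BorelSpace (GpInf L H) := ⟨rfl⟩
      letI : MeasurableSpace (GInf L) := borel _
      haveI : BorelSpace (GInf L) := ⟨rfl⟩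
      letI : MeasurableSpace (HInf L) := borel _
      haveI : BorelSpace (HInf L) := ⟨rfl⟩
      haveI : ∀ v : Places L, (νH v).IsHaarMeasure := isHaar_νH
      haveI : ∀ v : Places L, (νH v).IsMulRightInvariant := isRightInv_νH
      haveI : ∀ v : Places L, (νG v).IsHaarMeasure := isHaar_νG
      haveI : ∀ v : Places L, (νG v).IsMulRightInvariant := isRightInv_νG
      haveI : IsFiniteMeasureOnCompacts νGi := finCpt_νGi
      haveI : νGi.IsMulRightInvariant := rightInv_νGi
      haveI : IsFiniteMeasureOnCompacts νqi := finCpt_νqi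
      haveI : νqi.IsMulRightInvariant := rightInv_νqi
      haveI : IsFiniteMeasureOnCompacts νHi := finCpt_νHi
      haveI : νHi.IsMulRightInvariant := rightInv_νHi
      (∀ v : Places L, (mH v).IsCanonical (IsLocalGRegular L v) (νH v) ∧
          (mG v).IsCanonical (fun γ => IsRegularElt (γ.val : GL (Fin 3) (UnitaryGroup.LocalRing L v))) (νG v)) →
      ∀ (𝔨 : ComparisonKit L H μ) (hpin : 𝔨.IsPinned ν (archCanonicalTransferFactor L H μω) νH νG νGi νqi νHi), 𝔨.TransferExistence → 𝔨.SimpleTraceFormula → 𝔨.Δ = (finExplicitCollection L H μω (finExplicitDelta_conj_left_all L H μω) (finExplicitDelta_conj_right_all L H μω)) → 𝔨.mH = mH →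
        (∀ (v : Places L) (c' : ConjClasses ((cmDatum L 3 H).Local v)),
          Literature.NumberTheory.Rogawski1990.IsRegularElt ((Quotient.out c').val : GL (Fin 3) (UnitaryGroup.LocalRing L v)) → 𝔨.mG v c' = mG v c') →
        ∀ (hQ : CMCharIdentityPackageTestSigned L H (transpose_map_cmConjRingHom_eq_of_frame L ι H T hT) (isUnit_det_of_frame L ι H T hT) νH νG μω hμu (finExplicitCollection L H μω (finExplicitDelta_conj_left_all L H μω) (finExplicitDelta_conj_right_all L H μω)) mH mG),
          -- (H₇) LOCAL Δ‴-TRANSFER EXISTENCE AT NON-SPLIT `v` — the ONE hypothesis beyond the consumer telescope, in LH10 `DbTSAtRecordW1`'s `hex` bytes under σ (= A ED. 3 :139–:141 = B ED. 3 :473–:475;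
          -- ★ predicate `IsLocalDeltaTransferExists` of ★ `Literature…Rogawski1990.LocalTransferExistence`). NOTE: the consumer's `hΔ` (:160) is the kit pin `𝔨.Δ = Δ‴`, NOT this letter;
          -- `F0_P3c_PKtuplePaydown` ED. 6 carries no local-transfer-existence clause in its telescope (grep count 0), so (H₇) cannot be «bound by name» there — J7 pays it from LH10's `hex`.
          (∀ v : HeightOneSpectrum (𝓞 ↥(maximalRealSubfield L)), (∀ w : PlacesOver L v, IsCMField.complexConj L • w.1 = w.1) →
            IsLocalDeltaTransferExists L H v (finExplicitCollection L H μω (finExplicitDelta_conj_left_all L H μω) (finExplicitDelta_conj_right_all L H μω) v) (mH v) (mG v) Literature.NumberTheory.Rogawski1990.IsLocSmooth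
              Literature.NumberTheory.Rogawski1990.IsLocSmooth) →
          -- S9 PART (S9-R-K (2)): print's `ξ`, a discrete `P` of `U(H)` FIXED BY `K^c = ∏_{v∈S₀} K_v` (★ `IsKcSpherical`, p862338), then the ED. 3 tail under σ
          ∀ (ξ : OneDimAutRepH L) (P : DiscreteAutomorphicRep (Gp L H) μ) (hsph : IsKcSpherical L ι H T hT μ P),
          MemXiFamily P (transpose_map_cmConjRingHom_eq_of_frame L ι H T hT) (isUnit_det_of_frame L ι H T hT) μω hμu ξ →
          ∀ (v : HeightOneSpectrum (𝓞 ↥(maximalRealSubfield L))) (hns : ∀ w : PlacesOver L v, IsCMField.complexConj L • w.1 = w.1),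
          ∀ (T : GL (Fin 3) (LocalRing L v)) (a : LocalRing L v) (ha : IsUnit a)
            (h : formCongr (conjLocal L (IsCMField.complexConj L) v) T (H.map (algebraMap L (LocalRing L v))) =
              a • (Matrix.of fun i j : Fin 3 => if i.val + j.val + 1 = 3 then (1 : L) else 0).map (algebraMap L (LocalRing L v))),
          ∀ [MeasurableSpace (Gqs L v ⧸ Subgroup.center (Gqs L v))] [BorelSpace (Gqs L v ⧸ Subgroup.center (Gqs L v))]
            (μZ : Measure (Gqs L v ⧸ Subgroup.center (Gqs L v))) [μZ.IsHaarMeasure],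
          ∀ (π2 πn : IrrClass (Gqs L v)),
          ∀ (hK : KeysCaseTwoLabels L v (μω.semilocalComponent L v) (torusLocalComponent L (IsCMField.complexConj L) v ξ.η)
              (torusLocalComponent L (IsCMField.complexConj L) v ξ.ψ) π2 πn)
            (hn : ¬ πn.IsSquareIntegrable μZ),
            -- (S-U) «SC-UNIQUE»: every SUPERCUSPIDAL v-constituent of P IS the πˢ(ξ_v) ∘ e read off the SIGNED Q-package `hQS`
            ∀ c : IrrClass ((cmDatum L 3 H).Local v),
              (IrrClass.comap (localPiEquiv L (IsCMField.complexConj L) 3 H v) c).IsConstituentOf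
                  (P.finRep.smoothPart.toRepresentation.comp (inclPlace (↥(maximalRealSubfield L)) L (IsCMField.complexConj L) 3 H v)) →
              c.IsSupercuspidal →
              c = ((hQ ξ).1 v hns T a ha h μZ π2 πn hK hn).πs

open scoped Classical in
set_option synthInstance.maxHeartbeats 400000 in
set_option maxHeartbeats 8000000 in
/-- **(S-G-K) `SocketGlobalXiMembershipFramedKit`** — THE ED. 4 SOCKET (S9-R-K (2)): 13.3.6 (c) ∕ §14.6 at print's pinned data, at the letter's frame (`H` definite off `ι`, `[L⁺:ℚ] ≥ 2` as the letter binds it) and kit, for `K^c`-FIXED discrete `P` (★ `IsKcSpherical`, p862338): same telescope, then ED. 3 `SocketGlobalXiMembership` :308–:325 under σ.  Paid POINTWISE from FILE B's framed head `sock_S9_definiteAeRigidityFramedKit` through ★ p861905. [cite: Rogawski1990, §13.3 Thm. 13.3.5, Thm. 13.3.6 (c) p. 202; §14.6 Thm. 14.6.1 p. 241, Thm. 14.6.4 p. 243] -/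
def SocketGlobalXiMembershipFramedKit : Prop :=
  ∀ (L : Type) [Field L] [NumberField L] [IsCMField L] (ι : L →+* ℂ) (H : Matrix (Fin 3) (Fin 3) L) (T : GL (Fin 3) ℂ)
  (hT : (T : Matrix (Fin 3) (Fin 3) ℂ)ᴴ * H.map ι * (T : Matrix (Fin 3) (Fin 3) ℂ) = Literature.Geometry.ComplexHyperbolic.BallModel.J)
  (hdef : ∀ τ' : L →+* ℂ, InfinitePlace.mk τ' ≠ InfinitePlace.mk ι → (H.map τ').PosDef) (h2 : 2 ≤ Module.finrank ℚ ↥(maximalRealSubfield L))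
  (μ : Measure (Gp L H).automorphicQuotient) [(Gp L H).IsAutomorphicMeasure μ] (μω : HeckeCharacter L) (hμu : μω.IsUnitary)
  (hμω : ∀ x : Literature.NumberTheory.GaloisRepresentations.ideleGroup ↥(maximalRealSubfield L), μω (AdeleRing.ideleBaseChange (↥(maximalRealSubfield L)) L x) = quadraticHeckeCharCM L x)
  (ν : @Measure (GpAdelic L H) (borel _))
  (νH : ∀ v : Places L, @Measure (HLocal L v) (borel _)) (νG : ∀ v : Places L, @Measure (GpLocal L H v) (borel _))
  (νGi : @Measure (GpInf L H) (borel _)) (νqi : @Measure (GInf L) (borel _)) (νHi : @Measure (HInf L) (borel _))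
  (μZ : ∀ v : Places L, @Measure (Gqs L v ⧸ Subgroup.center (Gqs L v)) (borel _))
  (isHaar_ν : letI : MeasurableSpace (GpAdelic L H) := borel _; ν.IsHaarMeasure)
  (isInvInv_ν : letI : MeasurableSpace (GpAdelic L H) := borel _; ν.IsInvInvariant)
  (isHaar_νH : ∀ v : Places L, letI : MeasurableSpace (HLocal L v) := borel _; (νH v).IsHaarMeasure)
  (isRightInv_νH : ∀ v : Places L, letI : MeasurableSpace (HLocal L v) := borel _; (νH v).IsMulRightInvariant)
  (isHaar_νG : ∀ v : Places L, letI : MeasurableSpace (GpLocal L H v) := borel _; (νG v).IsHaarMeasure)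
  (isRightInv_νG : ∀ v : Places L, letI : MeasurableSpace (GpLocal L H v) := borel _; (νG v).IsMulRightInvariant)
  (finCpt_νGi : letI : MeasurableSpace (GpInf L H) := borel _; IsFiniteMeasureOnCompacts νGi)
  (rightInv_νGi : letI : MeasurableSpace (GpInf L H) := borel _; νGi.IsMulRightInvariant)
  (finCpt_νqi : letI : MeasurableSpace (GInf L) := borel _; IsFiniteMeasureOnCompacts νqi)
  (rightInv_νqi : letI : MeasurableSpace (GInf L) := borel _; νqi.IsMulRightInvariant)
  (finCpt_νHi : letI : MeasurableSpace (HInf L) := borel _; IsFiniteMeasureOnCompacts νHi)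
  (rightInv_νHi : letI : MeasurableSpace (HInf L) := borel _; νHi.IsMulRightInvariant)
  (isHaar_μZ : ∀ v : Places L, letI : MeasurableSpace (Gqs L v ⧸ Subgroup.center (Gqs L v)) := borel _; (μZ v).IsHaarMeasure)
  (hquad : ∀ v : Places L, (∀ w : PlacesOver L v, IsCMField.complexConj L • w.1 = w.1) →
    IsQuadraticCharExtension (conjLocal L (IsCMField.complexConj L) v) (μω.semilocalComponent L v))
  -- binders 33∕34: `vol_{νG_v}(K′_v) = 1` = `Rung0WitnessS.hK`, `vol_{νH_v}(K_{2,v} × K_{1,v}) = 1` = `Rung0WitnessS.hKH` (desk D35 (11)–(13); PROBE v7 :95–:99 VERBATIM)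
  (hvol : ∀ v : Places L, νG v (cmLocalIntegralLevel L 3 H v : Set (GpLocal L H v)) = 1)
  (hvolH : ∀ v : Places L,
    νH v (((cmLocalIntegralLevel L 2 (Matrix.of fun i j : Fin 2 => if i.val + j.val + 1 = 2 then (1 : L) else 0) v).prod
        (cmLocalIntegralLevel L 1 (Matrix.of fun i j : Fin 1 => if i.val + j.val + 1 = 1 then (1 : L) else 0) v) :
          Subgroup (HLocal L v)) : Set (HLocal L v)) = 1),
    -- SEAM 1 (S9-typ1 (g2) 22:17Z; import-free form, ★ `R90S8ResidualDefs` idiom): the kit ∕ `cmDatum`-keyed tokens below read the `Gp`-keyed automorphic-measure instance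
    haveI : (cmDatum L 3 H).IsAutomorphicMeasure μ := ‹(Gp L H).IsAutomorphicMeasure μ›
    letI : ∀ (v : Places L) (a : HLocal L v), MeasurableSpace (HLocal L v ⧸ Subgroup.centralizer ({a} : Set (HLocal L v))) := fun _ _ => borel _
    letI : ∀ (v : Places L) (γ : (cmDatum L 3 H).Local v),
        MeasurableSpace ((cmDatum L 3 H).Local v ⧸ Subgroup.centralizer ({γ} : Set ((cmDatum L 3 H).Local v))) := fun _ _ => borel _
    haveI : ∀ (v : Places L) (a : HLocal L v), BorelSpace (HLocal L v ⧸ Subgroup.centralizer ({a} : Set (HLocal L v))) := fun _ _ => ⟨rfl⟩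
    haveI : ∀ (v : Places L) (γ : (cmDatum L 3 H).Local v),
        BorelSpace ((cmDatum L 3 H).Local v ⧸ Subgroup.centralizer ({γ} : Set ((cmDatum L 3 H).Local v))) := fun _ _ => ⟨rfl⟩
    -- the K9 inner prefix of ★ `K9SpectralLetterSigned` (Defs :1402–:1447) VERBATIM, `hpin` NAMED
    ∀ (mH : ∀ v : Places L, OrbitalMeasureFamily (HLocal L v)) (mG : ∀ v : Places L, OrbitalMeasureFamily ((cmDatum L 3 H).Local v)),
      letI : MeasurableSpace (GpAdelic L H) := borel _
      haveI : BorelSpace (GpAdelic L H) := ⟨rfl⟩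
      haveI : ν.IsHaarMeasure := isHaar_ν
      haveI : ν.IsInvInvariant := isInvInv_ν
      letI : ∀ v : Places L, MeasurableSpace (GpLocal L H v) := fun _ => borel _
      haveI : ∀ v : Places L, BorelSpace (GpLocal L H v) := fun _ => ⟨rfl⟩
      letI : ∀ v : Places L, MeasurableSpace (HLocal L v) := fun _ => borel _
      haveI : ∀ v : Places L, BorelSpace (HLocal L v) := fun _ => ⟨rfl⟩
      letI : ∀ (v : Places L) (a : HLocal L v), MeasurableSpace (HLocal L v ⧸ Subgroup.centralizer ({a} : Set (HLocal L v))) := fun _ _ => borel _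
      letI : ∀ (v : Places L) (γ : GpLocal L H v), MeasurableSpace (GpLocal L H v ⧸ Subgroup.centralizer ({γ} : Set (GpLocal L H v))) := fun _ _ => borel _
      letI : MeasurableSpace (GpInf L H) := borel _
      haveI : BorelSpace (GpInf L H) := ⟨rfl⟩
      letI : MeasurableSpace (GInf L) := borel _
      haveI : BorelSpace (GInf L) := ⟨rfl⟩
      letI : MeasurableSpace (HInf L) := borel _
      haveI : BorelSpace (HInf L) := ⟨rfl⟩
      haveI : ∀ v : Places L, (νH v).IsHaarMeasure := isHaar_νH
      haveI : ∀ v : Places L, (νH v).IsMulRightInvariant := isRightInv_νH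
      haveI : ∀ v : Places L, (νG v).IsHaarMeasure := isHaar_νG
      haveI : ∀ v : Places L, (νG v).IsMulRightInvariant := isRightInv_νG
      haveI : IsFiniteMeasureOnCompacts νGi := finCpt_νGi
      haveI : νGi.IsMulRightInvariant := rightInv_νGi
      haveI : IsFiniteMeasureOnCompacts νqi := finCpt_νqi
      haveI : νqi.IsMulRightInvariant := rightInv_νqi
      haveI : IsFiniteMeasureOnCompacts νHi := finCpt_νHi
      haveI : νHi.IsMulRightInvariant := rightInv_νHi
      (∀ v : Places L, (mH v).IsCanonical (IsLocalGRegular L v) (νH v) ∧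
          (mG v).IsCanonical (fun γ => IsRegularElt (γ.val : GL (Fin 3) (UnitaryGroup.LocalRing L v))) (νG v)) →
      ∀ (𝔨 : ComparisonKit L H μ) (hpin : 𝔨.IsPinned ν (archCanonicalTransferFactor L H μω) νH νG νGi νqi νHi), 𝔨.TransferExistence → 𝔨.SimpleTraceFormula → 𝔨.Δ = (finExplicitCollection L H μω (finExplicitDelta_conj_left_all L H μω) (finExplicitDelta_conj_right_all L H μω)) → 𝔨.mH = mH →
        (∀ (v : Places L) (c' : ConjClasses ((cmDatum L 3 H).Local v)),
          Literature.NumberTheory.Rogawski1990.IsRegularElt ((Quotient.out c').val : GL (Fin 3) (UnitaryGroup.LocalRing L v)) → 𝔨.mG v c' = mG v c') →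
        ∀ (hQ : CMCharIdentityPackageTestSigned L H (transpose_map_cmConjRingHom_eq_of_frame L ι H T hT) (isUnit_det_of_frame L ι H T hT) νH νG μω hμu (finExplicitCollection L H μω (finExplicitDelta_conj_left_all L H μω) (finExplicitDelta_conj_right_all L H μω)) mH mG),
          -- (H₇) LOCAL Δ‴-TRANSFER EXISTENCE AT NON-SPLIT `v` — the ONE hypothesis beyond the consumer telescope, in LH10 `DbTSAtRecordW1`'s `hex` bytes under σ (= A ED. 3 :139–:141 = B ED. 3 :473–:475;
          -- ★ predicate `IsLocalDeltaTransferExists` of ★ `Literature…Rogawski1990.LocalTransferExistence`). NOTE: the consumer's `hΔ` (:160) is the kit pin `𝔨.Δ = Δ‴`, NOT this letter;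
          -- `F0_P3c_PKtuplePaydown` ED. 6 carries no local-transfer-existence clause in its telescope (grep count 0), so (H₇) cannot be «bound by name» there — J7 pays it from LH10's `hex`.
          (∀ v : HeightOneSpectrum (𝓞 ↥(maximalRealSubfield L)), (∀ w : PlacesOver L v, IsCMField.complexConj L • w.1 = w.1) →
            IsLocalDeltaTransferExists L H v (finExplicitCollection L H μω (finExplicitDelta_conj_left_all L H μω) (finExplicitDelta_conj_right_all L H μω) v) (mH v) (mG v) Literature.NumberTheory.Rogawski1990.IsLocSmooth
              Literature.NumberTheory.Rogawski1990.IsLocSmooth) →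
          -- S9 PART (S9-R-K (2)): print's `ξ`, a discrete `P` of `U(H)` FIXED BY `K^c = ∏_{v∈S₀} K_v` (★ `IsKcSpherical`, p862338), then the ED. 3 tail under σ
          ∀ (ξ : OneDimAutRepH L) (P : DiscreteAutomorphicRep (Gp L H) μ) (hsph : IsKcSpherical L ι H T hT μ P),
          MemXiFamily P (transpose_map_cmConjRingHom_eq_of_frame L ι H T hT) (isUnit_det_of_frame L ι H T hT) μω hμu ξ →
          ∀ (v : HeightOneSpectrum (𝓞 ↥(maximalRealSubfield L))) (hns : ∀ w : PlacesOver L v, IsCMField.complexConj L • w.1 = w.1),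
          ∀ (T : GL (Fin 3) (LocalRing L v)) (a : LocalRing L v) (ha : IsUnit a)
            (h : formCongr (conjLocal L (IsCMField.complexConj L) v) T (H.map (algebraMap L (LocalRing L v))) =
              a • (Matrix.of fun i j : Fin 3 => if i.val + j.val + 1 = 3 then (1 : L) else 0).map (algebraMap L (LocalRing L v))),
          ∀ [MeasurableSpace (Gqs L v ⧸ Subgroup.center (Gqs L v))] [BorelSpace (Gqs L v ⧸ Subgroup.center (Gqs L v))]
            (μZ : Measure (Gqs L v ⧸ Subgroup.center (Gqs L v))) [μZ.IsHaarMeasure],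
          ∀ (π2 πn : IrrClass (Gqs L v)),
          ∀ (hK : KeysCaseTwoLabels L v (μω.semilocalComponent L v) (torusLocalComponent L (IsCMField.complexConj L) v ξ.η)
              (torusLocalComponent L (IsCMField.complexConj L) v ξ.ψ) π2 πn)
            (hn : ¬ πn.IsSquareIntegrable μZ),
            -- (S-G) «13.3.6 (c) ∕ §14.6 AT PRINT'S PINNED DATA»: every v-constituent of P is πⁿ ∘ e, π² ∘ e, or the πˢ(ξ_v) ∘ e of `hQS`
            ∀ c : IrrClass ((cmDatum L 3 H).Local v),
              (IrrClass.comap (localPiEquiv L (IsCMField.complexConj L) 3 H v) c).IsConstituentOf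
                  (P.finRep.smoothPart.toRepresentation.comp (inclPlace (↥(maximalRealSubfield L)) L (IsCMField.complexConj L) 3 H v)) →
              c = IrrClass.comap (cmDatumLocalCongr L v T ha h).symm πn ∨
                c = IrrClass.comap (cmDatumLocalCongr L v T ha h).symm π2 ∨
                c = ((hQ ξ).1 v hns T a ha h μZ π2 πn hK hn).πs

/-! ## §5.2 Junctions at the frame (PROVED, no sorry; proofs = ED. 3 J1∕J1⁻¹∕J2∕J3 with the longer intro spine) -/

set_option synthInstance.maxHeartbeats 400000 in
set_option maxHeartbeats 8000000 in
/-- **J1-K `(S-G-K) → (S-U-K)`** (★ `F0P3cStCharTSNe.ne_comap_keysLabels_of_isSupercuspidal`). No sorry. -/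
theorem scUniqueFK_of_globalXiMembershipFK (hG : SocketGlobalXiMembershipFramedKit) : SocketScUniqueFramedKit := by
  intro L _ _ _ ι H T hT hdef h2 μ _ μω hμu hμω ν νH νG νGi νqi νHi μZ isHaar_ν isInvInv_ν isHaar_νH isRightInv_νH isHaar_νG isRightInv_νG finCpt_νGi rightInv_νGi finCpt_νqi rightInv_νqi finCpt_νHi rightInv_νHi isHaar_μZ hquad hvol hvolH mH mG hcan 𝔨 hpin htE hstf hΔk hmH hmG hQ hex ξ P hsph hmem v hns Tv a ha h _ _ μZv _ π2 πn hKl hn c hc hsc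
  rcases hG L ι H T hT hdef h2 μ μω hμu hμω ν νH νG νGi νqi νHi μZ isHaar_ν isInvInv_ν isHaar_νH isRightInv_νH isHaar_νG isRightInv_νG finCpt_νGi rightInv_νGi finCpt_νqi rightInv_νqi finCpt_νHi rightInv_νHi isHaar_μZ hquad hvol hvolH mH mG hcan 𝔨 hpin htE hstf hΔk hmH hmG hQ hex ξ P hsph hmem v hns Tv a ha h μZv π2 πn hKl hn c hc with hπn | hπ2 | hπs
  · exact absurd hπn (F0P3cStCharTSNe.ne_comap_keysLabels_of_isSupercuspidal L H v hns Tv a ha h (μω.semilocalComponent L v)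
      (torusLocalComponent L (IsCMField.complexConj L) v ξ.η) (torusLocalComponent L (IsCMField.complexConj L) v ξ.ψ) π2 πn hKl c hsc).1
  · exact absurd hπ2 (F0P3cStCharTSNe.ne_comap_keysLabels_of_isSupercuspidal L H v hns Tv a ha h (μω.semilocalComponent L v)
      (torusLocalComponent L (IsCMField.complexConj L) v ξ.η) (torusLocalComponent L (IsCMField.complexConj L) v ξ.ψ) π2 πn hKl c hsc).2
  · exact hπs

set_option synthInstance.maxHeartbeats 400000 in
set_option maxHeartbeats 8000000 in
/-- **J1⁻¹-K `(S-U-K) → (S-G-K)`** (★ `F0P3cDbTEnvelopeTrichotomy.constituent_trichotomy_of_memXiFamily`, p848339). No sorry. -/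
theorem globalXiMembershipFK_of_scUniqueFK (hU : SocketScUniqueFramedKit) : SocketGlobalXiMembershipFramedKit := by
  intro L _ _ _ ι H T hT hdef h2 μ _ μω hμu hμω ν νH νG νGi νqi νHi μZ isHaar_ν isInvInv_ν isHaar_νH isRightInv_νH isHaar_νG isRightInv_νG finCpt_νGi rightInv_νGi finCpt_νqi rightInv_νqi finCpt_νHi rightInv_νHi isHaar_μZ hquad hvol hvolH mH mG hcan 𝔨 hpin htE hstf hΔk hmH hmG hQ hex ξ P hsph hmem v hns Tv a ha h _ _ μZv _ π2 πn hKl hn c hc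
  rcases F0P3cDbTEnvelopeTrichotomy.constituent_trichotomy_of_memXiFamily L H (transpose_map_cmConjRingHom_eq_of_frame L ι H T hT) (isUnit_det_of_frame L ι H T hT) μω hμu ξ P hmem v hns Tv a ha h π2 πn hKl c hc with hπn | hπ2 | hsc
  · exact Or.inl hπn
  · exact Or.inr (Or.inl hπ2)
  · exact Or.inr (Or.inr (hU L ι H T hT hdef h2 μ μω hμu hμω ν νH νG νGi νqi νHi μZ isHaar_ν isInvInv_ν isHaar_νH isRightInv_νH isHaar_νG isRightInv_νG finCpt_νGi rightInv_νGi finCpt_νqi rightInv_νqi finCpt_νHi rightInv_νHi isHaar_μZ hquad hvol hvolH mH mG hcan 𝔨 hpin htE hstf hΔk hmH hmG hQ hex ξ P hsph hmem v hns Tv a ha h μZv π2 πn hKl hn c hc hsc))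

open scoped Classical in
set_option synthInstance.maxHeartbeats 400000 in
set_option maxHeartbeats 8000000 in
/-- **J2-K `(S-U-K) → (O2♮-K)`** (★ `CMNonsplitCharIdentityAtTestSigned.charIdentityAtTestSigned_πs`; the letter's borel carpet re-pinned for the ★ term). No sorry. -/
theorem topFK_of_scUniqueFK (hU : SocketScUniqueFramedKit) : TopXiPacketRigidCoreScFramedKit := by
  intro L _ _ _ ι H T hT hdef h2 μ _ μω hμu hμω ν νH νG νGi νqi νHi μZ isHaar_ν isInvInv_ν isHaar_νH isRightInv_νH isHaar_νG isRightInv_νG finCpt_νGi rightInv_νGi finCpt_νqi rightInv_νqi finCpt_νHi rightInv_νHi isHaar_μZ hquad hvol hvolH mH mG hcan 𝔨 hpin htE hstf hΔk hmH hmG hQ hex ξ P hsph hmem v hns Tv a ha h _ _ μZv _ π2 πn hKl hn c hc hsc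
  obtain rfl := hU L ι H T hT hdef h2 μ μω hμu hμω ν νH νG νGi νqi νHi μZ isHaar_ν isInvInv_ν isHaar_νH isRightInv_νH isHaar_νG isRightInv_νG finCpt_νGi rightInv_νGi finCpt_νqi rightInv_νqi finCpt_νHi rightInv_νHi isHaar_μZ hquad hvol hvolH mH mG hcan 𝔨 hpin htE hstf hΔk hmH hmG hQ hex ξ P hsph hmem v hns Tv a ha h μZv π2 πn hKl hn c hc hsc
  letI : ∀ (v : Places L) (a : HLocal L v), MeasurableSpace (HLocal L v ⧸ Subgroup.centralizer ({a} : Set (HLocal L v))) := fun _ _ => borel _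
  letI : ∀ (v : Places L) (γ : (cmDatum L 3 H).Local v),
      MeasurableSpace ((cmDatum L 3 H).Local v ⧸ Subgroup.centralizer ({γ} : Set ((cmDatum L 3 H).Local v))) := fun _ _ => borel _
  haveI : ∀ (v : Places L) (a : HLocal L v), BorelSpace (HLocal L v ⧸ Subgroup.centralizer ({a} : Set (HLocal L v))) := fun _ _ => ⟨rfl⟩
  haveI : ∀ (v : Places L) (γ : (cmDatum L 3 H).Local v),
      BorelSpace ((cmDatum L 3 H).Local v ⧸ Subgroup.centralizer ({γ} : Set ((cmDatum L 3 H).Local v))) := fun _ _ => ⟨rfl⟩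
  letI : ∀ v : Places L, MeasurableSpace (GpLocal L H v) := fun _ => borel _
  haveI : ∀ v : Places L, BorelSpace (GpLocal L H v) := fun _ => ⟨rfl⟩
  letI : ∀ v : Places L, MeasurableSpace (HLocal L v) := fun _ => borel _
  haveI : ∀ v : Places L, BorelSpace (HLocal L v) := fun _ => ⟨rfl⟩
  letI : ∀ (v : Places L) (a : HLocal L v), MeasurableSpace (HLocal L v ⧸ Subgroup.centralizer ({a} : Set (HLocal L v))) := fun _ _ => borel _
  letI : ∀ (v : Places L) (γ : GpLocal L H v), MeasurableSpace (GpLocal L H v ⧸ Subgroup.centralizer ({γ} : Set (GpLocal L H v))) := fun _ _ => borel _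
  haveI : ∀ v : Places L, (νH v).IsHaarMeasure := isHaar_νH
  haveI : ∀ v : Places L, (νH v).IsMulRightInvariant := isRightInv_νH
  haveI : ∀ v : Places L, (νG v).IsHaarMeasure := isHaar_νG
  haveI : ∀ v : Places L, (νG v).IsMulRightInvariant := isRightInv_νG
  exact ((hQ ξ).1 v hns Tv a ha h μZv π2 πn hKl hn).charIdentityAtTestSigned_πs

/-- **HEAD-K `(S-G-K) → (O2♮-K)`** (J2-K ∘ J1-K). No sorry. -/
theorem topFK_of_globalXiMembershipFK (hG : SocketGlobalXiMembershipFramedKit) : TopXiPacketRigidCoreScFramedKit :=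
  topFK_of_scUniqueFK (scUniqueFK_of_globalXiMembershipFK hG)

open scoped Classical in
set_option synthInstance.maxHeartbeats 400000 in
set_option maxHeartbeats 8000000 in
/-- **J3-K `(O2♮-K) → (S-U-K)`** (★ p861411 `R90.S9.eq_packagePis_of_charIdentityAtTestSigned`, signed completion uniqueness under (H₇) = the KEPT `hex`). No sorry. -/
theorem scUniqueFK_of_topFK (hT' : TopXiPacketRigidCoreScFramedKit) : SocketScUniqueFramedKit := by
  intro L _ _ _ ι H T hT hdef h2 μ _ μω hμu hμω ν νH νG νGi νqi νHi μZ isHaar_ν isInvInv_ν isHaar_νH isRightInv_νH isHaar_νG isRightInv_νG finCpt_νGi rightInv_νGi finCpt_νqi rightInv_νqi finCpt_νHi rightInv_νHi isHaar_μZ hquad hvol hvolH mH mG hcan 𝔨 hpin htE hstf hΔk hmH hmG hQ hex ξ P hsph hmem v hns Tv a ha h _ _ μZv _ π2 πn hKl hn c hc hsc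
  letI : ∀ (v : Places L) (a : HLocal L v), MeasurableSpace (HLocal L v ⧸ Subgroup.centralizer ({a} : Set (HLocal L v))) := fun _ _ => borel _
  letI : ∀ (v : Places L) (γ : (cmDatum L 3 H).Local v),
      MeasurableSpace ((cmDatum L 3 H).Local v ⧸ Subgroup.centralizer ({γ} : Set ((cmDatum L 3 H).Local v))) := fun _ _ => borel _
  haveI : ∀ (v : Places L) (a : HLocal L v), BorelSpace (HLocal L v ⧸ Subgroup.centralizer ({a} : Set (HLocal L v))) := fun _ _ => ⟨rfl⟩
  haveI : ∀ (v : Places L) (γ : (cmDatum L 3 H).Local v),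
      BorelSpace ((cmDatum L 3 H).Local v ⧸ Subgroup.centralizer ({γ} : Set ((cmDatum L 3 H).Local v))) := fun _ _ => ⟨rfl⟩
  letI : ∀ v : Places L, MeasurableSpace (GpLocal L H v) := fun _ => borel _
  haveI : ∀ v : Places L, BorelSpace (GpLocal L H v) := fun _ => ⟨rfl⟩
  letI : ∀ v : Places L, MeasurableSpace (HLocal L v) := fun _ => borel _
  haveI : ∀ v : Places L, BorelSpace (HLocal L v) := fun _ => ⟨rfl⟩
  letI : ∀ (v : Places L) (a : HLocal L v), MeasurableSpace (HLocal L v ⧸ Subgroup.centralizer ({a} : Set (HLocal L v))) := fun _ _ => borel _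
  letI : ∀ (v : Places L) (γ : GpLocal L H v), MeasurableSpace (GpLocal L H v ⧸ Subgroup.centralizer ({γ} : Set (GpLocal L H v))) := fun _ _ => borel _
  haveI : ∀ v : Places L, (νH v).IsHaarMeasure := isHaar_νH
  haveI : ∀ v : Places L, (νH v).IsMulRightInvariant := isRightInv_νH
  haveI : ∀ v : Places L, (νG v).IsHaarMeasure := isHaar_νG
  haveI : ∀ v : Places L, (νG v).IsMulRightInvariant := isRightInv_νG
  exact eq_packagePis_of_charIdentityAtTestSigned L H (transpose_map_cmConjRingHom_eq_of_frame L ι H T hT) (isUnit_det_of_frame L ι H T hT) νG hQ ξ v hns (hex v hns) Tv a ha h μZv π2 πn hKl hn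
    (hT' L ι H T hT hdef h2 μ μω hμu hμω ν νH νG νGi νqi νHi μZ isHaar_ν isInvInv_ν isHaar_νH isRightInv_νH isHaar_νG isRightInv_νG finCpt_νGi rightInv_νGi finCpt_νqi rightInv_νqi finCpt_νHi rightInv_νHi isHaar_μZ hquad hvol hvolH mH mG hcan 𝔨 hpin htE hstf hΔk hmH hmG hQ hex ξ P hsph hmem v hns Tv a ha h μZv π2 πn hKl hn c hc hsc)

/-- (O2♮-K) ⟺ (S-G-K) over ★. No sorry. -/
theorem topFK_iff_globalXiMembershipFK : TopXiPacketRigidCoreScFramedKit ↔ SocketGlobalXiMembershipFramedKit :=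
  ⟨fun h => globalXiMembershipFK_of_scUniqueFK (scUniqueFK_of_topFK h), topFK_of_globalXiMembershipFK⟩

/-- (O2♮-K) ⟺ (S-U-K) over ★. No sorry. -/
theorem topFK_iff_scUniqueFK : TopXiPacketRigidCoreScFramedKit ↔ SocketScUniqueFramedKit :=
  ⟨scUniqueFK_of_topFK, topFK_of_scUniqueFK⟩

end Summit.HodgeConjecture.HodgeConjecture.R90.S9

end
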